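import Literature.MathematicalPhysics.QuantumFieldTheory.Balaban1983to89.B9Cor38Whole

/-!
# `Balaban1983to89.B9Thm310Whole` — [B9] Theorem 3.10 (pp. 415–416) AS THE WHOLE PRINTED LEAF `B9.Thm310Printed` at a
# PINNED expansion datum `W310OfOps` for the random walk expansion (3.107) of G: a glue module over the block-majorant
# engines of the lineage `B9Thm37Sum` ∕ `B9Thm37Glue` ∕ `B6RandomWalkHom` (the Theorem 3.10 twin of `B9Thm37Whole` + `B9Cor38Whole`)

T. Bałaban, *Propagators for lattice gauge theories in a background field*, Commun. Math. Phys. **99** (1985) 389–434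
[`Balaban1985BackgroundPropagators`, "B9"]; [4] = T. Bałaban, *Propagators and renormalization transformations for lattice
gauge theories. II*, Commun. Math. Phys. **96** (1984) 223–250 [`Balaban1984PropagatorsII`].

statement-level skeleton of published theorems with citation tags; proofs where landed; nothing here is a claim about the
Yang–Mills mass gap

THE PRINTED LOCI (verbatim).  p. 414, (3.105)–(3.106): *"Applying this formula to Δ_aG₀ we get Δ_aG₀ = I − Σ_□K(h_□)G_□h_□
− Σ_□(1 − ζ_□̃)DPD\*h_□G_□h_□ − Σ_□ζ_□̃(DPD\* − DP_□D\*)h_□G_□h_□ − Σ_□ζ_□̃P_{□,1}(∂h_□)G_□h_□ = I − R, (3.105) … The operator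
K(h_□)G_□h_□ satisfies the inequality (3.89), hence it is small. Next we will analyze the other operators in R and we will prove
that they are small also. More exactly, it will follow from this analysis that R satisfies the bound (3.85) with O(M⁻¹) instead
of O(α₁). For M sufficiently large this implies G = G₀(I − R)⁻¹ = Σ_{n=0}^∞ G₀Rⁿ. (3.106)"*; p. 413 (the factors of the
generalized walks): *"Thus a random walk ω is a sequence ω = ((α₀,X₀), (α₁,X₁),…,(αₙ,Xₙ)). We will have always α₀ = 0. Let
us again denote |ω| = n. An operator R_α(X) has the following important properties: it is localized in X, i.e. its kernel has
a support in X × X, it depends on U restricted to X̃⁵, and satisfies a bound of the type (3.89), possibly with an additional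
power of L^jη. It is difficult to make the last statement more precise. Instead we will write a bound for a whole term in the
expansion."*; p. 415: *"Thus we have decomposed R and G into convergent expansions, the terms in the expansion of R being small.
The factors in these expansions are very similar to the factors R_α(X) in (3.98), we have only few possibilities more, like the
operators K(h_□)G_□h_□, ζ_□̃Dh′_{□₀}G′_{□₀}h′_{□₀}Q′\*, etc. The above considerations give Theorem 3.10. For M sufficiently
large, and a configuration U satisfying (3.95) [sic — (3.35)], the operator G has the expansion G = Σ_ω R₀(X₀)R_{α₁}(X₁)·⋯·
R_{αₙ}(Xₙ), (3.107) the sum is over walks ω = ((0, X₀), (α₁,X₁),…,(αₙ, Xₙ)) satisfying X_{i−1} ∩ X_i ≠ ∅, i = 1,…, n. A term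
in this expansion, corresponding to a walk ω, depends on configuration U restricted to X̃⁵₀ ∪ X̃⁵₁ ∪ … ∪ X̃⁵ₙ, satisfies the
inequality |(R₀(X₀)R_{α₁}(X₁)·⋯·R_{αₙ}(Xₙ)J)(x)| ≦ O(1)(L^jη)²O(M^{−1/2})^{|ω|}M^{−1/2|ω|}e^{−(1/2)δ₀d(ω,y,y′)}|J|, x ∈ Δ(y),
y ∈ Λ_j, supp J ⊂ Δ(y′), (3.108) and the corresponding inequalities for norms on the left-hand sides of (3.42)–(3.47). The
constant O(1) depends on d and L only. From (3.108) it follows that the expansion (3.107) is convergent in all norms in the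
inequalities (3.42)–(3.47). This implies Theorem 3.3."*; p. 409: *"The operators constructed for this sequence, which we
denote by G′_□(U), C_□(U) = …, G_□(U), satisfy all the inequalities of Theorems 3.1–3.3 correspondingly."*; (3.87):
*"G₀ = Σ_{□∈𝒟} h_□G_□h_□"*; Theorem 3.3, p. 399: *"the operator G(U) (a = 1) satisfies the inequalities (3.42)–(3.47),
with G′(U) replaced by G(U) and λ replaced by a function J defined at bonds"*.

THE POINT.  The cell's typed skeleton `…Balaban1983to89.B9` carries Theorem 3.10 as ONE predicate over ABSTRACT expansion
data, `B9.Thm310Printed c35 geo bg E` = "∃ M₂ a₀ δ₀ C c > 0, ∀ i, M₂ ≤ M → ∀ α₀ > 0, Mα₀ ≤ a₀ → ∀ U, (3.35) →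
(E i).Converges U ∧ ∀ ω J y y′, … → (E i).LocDep U ω ∧ (E i).term U ω J y ≦ (L^jη)²·walkFactor C c M δ₀ |ω| d(ω,y,y′)·|J|"
with `E : ∀ i, B9.RWExpansion (geo i) (bg i)` FREE data; the knit `DagBinding.B9LeafX` ∕ the N06 certificate of record
(`Summit…N06AtRecord11CB10YZW.b9_main_of_up_view₁₁B10YZW_of_obligations`, binder `t310`) consumes it only as a hypothesis, and
through `B9.thm33_of_thm37_310` together with the summation leaf `B9.RWSumsYieldIneqs`.  THIS FILE is the Theorem 3.10 twin
of the sibling pair `B9Thm37Whole` (Theorem 3.7 at `E37OfOps`) ∕ `B9Cor38Whole` (Corollary 3.8 at `W38OfOps`):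

* §1 `Ops310 g B X Y ι A` — the operator letters of (3.87), (3.105)–(3.107) at ONE family member as functions of U: G(U)
  ((3.27)), Δ_a(U), the local propagators G_□(U) (p. 409), ∇_U, ∇\*_U, Δ_U, the Leibniz letters of ∇_U ∕ Δ_U ∕ ∇\*_U through
  M_{h_□} with their coefficient kernels, the partition data {h_□}, S_□, S′_□ — and THE ELEMENTARY FACTORS R_α(X)(U) of
  (3.107), indexed by a finite type `A` (print's pairs (α, X), α ≠ 0), as OPAQUE letters `Rf U a` with localization sets
  `SF a` (= X ∩ 𝔅), together with the factors `Rt U a` of the transposed identity G₀Δ_a = I − Σ_a Rt U a used for the right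
  entry G∇\*_U (print: *"It is difficult to make the last statement more precise"* — the factors carry a HYPOTHESIS SCHEMA
  of the printed (3.89) shape, §2, nothing more); `Conv3107 𝔬 R H C δ U` — «the sum (3.107) G(U) obeys the four inequalities
  (3.42) (G′ ↦ G, λ ↦ J) with constants (C, δ)» in the lineage's shapes; the readings `WalkReading310` (evaluation of J,
  agreement of configurations on □̃⁵ ∕ X̃⁵); ★ `W310OfOps 𝔬 rd Conv : B9.RWExpansion g B` with EVERY field pinned: walks
  (n, □₀, a) reading ((0, □₀), a₁, …, aₙ), |ω| = n, the end conditions, d(ω, y, y′) of (3.93) by `B9Cor38Whole.minLen` over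
  X₁ ∩ 𝔅, …, Xₙ ∩ 𝔅, the term = the block sup of |(h_{□₀}G_{□₀}h_{□₀}R_{a₁}⋯R_{aₙ}J)(x)|, the U-localisation clause, and
  `Converges := Conv` — the convergence predicate is a PARAMETER of the datum: this file inhabits the leaf at the sup-block pin
  `Conv := Conv3107 𝔬 R H C δ`; the sibling `B9RWSums343to347Whole` conjoins the Hölder ∕ L² ∕ weighted blocks of Theorem 3.3 to
  it (seat n06-d's INTERFACE-2b: the summation leaf `B9.RWSumsYieldIneqs` is proviso-free, so everything it yields must sit in
  `Converges`), both through the pin-generic `thm310Printed_of_parts`.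
* §2 the hypothesis schemas (`Prop`-structures of printed shape, nothing asserted): `Sizes310` (Leibniz sizes), `StaticOK310`
  (geometry of d, partition of unity, overlap counts N, N′, N_F, comparability C_ℓ, Leibniz kernels), `Local342G` («G_□(U)
  satisfy all the inequalities of Theorems 3.1–3.3», p. 409: entries 1–4 of (3.42) for every G_□(U)), `Factors389` (the
  (3.89)-type bounds of the factors with O(M⁻¹) = θ₀M⁻¹, p. 414 «R satisfies the bound (3.85) with O(M⁻¹)» — the smallness
  of the four families of pieces of R, GAPS G-B9-05 ∕ G-B9-06a ∕ G-B9-07 of the cell, is NOT proved here), `Identities310`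
  (GΔ_a = I = Δ_aG, (3.105) and its transpose, the Leibniz rules and majorants), `Locality310` (G_□ depends on U|□̃⁵, R_α(X)
  on U|X̃⁵ — p. 410 ∕ p. 413).
* §3 one member, one U: `conv3107_of_local3107` — the four entries of (3.42) for the sum G(U) with ONE pair of constants
  (C = `B9Thm37Whole.const37 …`, δ = (1 − 2α)δ₀) under the located smallness N_F·θ₀M⁻¹·c₁(α) ≦ ½; `locDep_W310OfOps`;
  `term_W310OfOps_le` — the bound (3.108).
* §4 `thm310Printed_of_parts` (any pin: convergence content under provisos + (3.108) + localisation ⇒ the leaf);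
  ★ `thm310Printed_of_local3107` — **THE WHOLE PRINTED LEAF** `B9.Thm310Printed c35 geo bg (fun i => W310OfOps … (Conv3107 …))` from
  the schemas under the printed provisos of Corollary 3.6 (M ≧ M₁, 0 < α₀, O(1)Mα₀ ≦ a₁, (3.35)) and [4] Lemma 2.1 (2.61)
  for M ≧ M_L («for M sufficiently large»: M₂ := max(M₁, M_L, 2N_Fθ₀c₁(α)), a₀ := a₁∕O(1)).
* §5 `clause342_of_thm310Printed` — the consumer face: with n06-c's co-readings `B9Thm37GlueCor36.CoRealizes` of the four
  model operators by the observation quantities of a kernel family `GA i`, the leaf at `W310OfOps` gives the four (3.42)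
  clauses for `GA i` under its provisos — the (3.42) block of the G-half of `B9.RWSumsYieldIneqs` ∕ of `B9.Thm33Printed`
  (p. 416: *"This implies Theorem 3.3"*), so the pinned `Converges` is not junk-closable.

HONEST SCOPE.  Nothing of print is asserted: Corollary 3.6 for the G_□, the identities (3.105), GΔ_a = I, the Leibniz rules
and kernel sizes (NOT displayed in print, cell GAPS G-pv21g4-1 (i)), the counts N, N′, N_F (G-B9-22), the (3.89)-type
bounds of the factors R_α(X) and of their transposes (p. 413 ∕ p. 414, by reference to [4] Prop. 2.2 ∕ (2.135); GAPS
G-B9-05∕06a∕07), [4] Lemma 2.1 (2.61) and the geometry of d are HYPOTHESES of printed shape; `Conv3107` covers the sup block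
(3.42) only — *"the corresponding inequalities for norms on the left-hand sides of (3.42)–(3.47)"* (Hölder ∕ L² ∕ weighted
members) are the `B9Thm37AllNorms*` engines ∕ the sibling `B9RWSums343to347Whole` and are not conjoined here; the walks are
indexed by (n, □₀, a) ∈ ℕ × ι × (ℕ → A) (the printed adjacency X_{i−1} ∩ X_i ≠ ∅ is not imposed — non-adjacent sequences
obey the same bound); the rate comes out as (1 − 2α)δ₀.  Value: kernel-checked bookkeeping — the printed leaf inhabited over
the lineage's objects — NOT a node discharge, NOT summit progress; one finite lattice paper; nothing continuum, nothing about
the mass gap.  Cell `pub-ymgap` (HUMAN RULING D-0062), Track A node N06 [B9], seat `pub-ymgap-dag-n06-k` (N06-ASSIGNMENT v1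
row 18), 2026-08-26.
-/

namespace Literature.MathematicalPhysics.QuantumFieldTheory.Balaban1983to89.B9Thm310Whole

open Literature.MathematicalPhysics.QuantumFieldTheory.Balaban1983to89
open Finset B6RandomWalk B6RandomWalkHom B9Thm37Sum B9Thm34Ext B9Thm37Glue B9Thm37Whole B9Cor38Whole

noncomputable section

/-! ## §1 The letters of (3.87), (3.105)–(3.107) at one member; the convergence content; the pinned datum -/

section OneMember

variable {g : B9.Geometry} [Fintype g.Site] [DecidableEq g.Site] {B : B9.Backgrounds} {X Y ι A : Type}

/-- **THE LETTERS OF THE EXPANSION (3.107) AT ONE FAMILY MEMBER**, as total functions of the background U, over a lattice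
`X` of (bond) points where G acts (block map `blk` into 𝔅), a lattice `Y` where ∇_UJ lives (block map `blkY`), the cube index
`ι` = 𝒟 (p. 408) and the FACTOR index `A` (print's pairs (α, X), α ≠ 0, p. 413): `G U` = G(U) ((3.27)); `Δa U` = Δ_a(U);
`Gsq U □` = G_□(U) (p. 409); `Rf U a` = the elementary factor R_α(X)(U) of (3.107) — a summand of R in (3.105) after the
substitutions of p. 415 — and `Rt U a` = the corresponding factor of the transposed identity G₀Δ_a = I − Σ_a R♯_a (used for the
right entry G∇\*_U); `D U` = ∇_U, `Dstar U` = ∇\*_U, `Lap U` = Δ_U; `PD`, `CD` ∕ `PL`, `CL` ∕ `CLt` = the letters of the Leibniz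
rules of ∇_U ∕ Δ_U ∕ ∇\*_U through M_{h_□} ((3.100), (3.88) first line) with nonnegative coefficient kernels `KPD … KCLt`; `h`, `hY`
= the partition of unity {h_□} on `X` ∕ `Y` (p. 408: Σ_□h²_□ = 1); `S □`, `S' □` = the blocks met by supp h_□ ∕ by the Leibniz
coefficients ∂h_□; `SF a` = the blocks of the localization domain X of the factor `a` (p. 413: *"it is localized in X, i.e. its
kernel has a support in X × X"*).  A PARAMETER RECORD — nothing is constructed or asserted (pattern of `B9Thm37Whole.Ops`).
[cite: Balaban1985BackgroundPropagators, (3.87) p.409 + (3.105)–(3.107) pp.414–416 + p.413] -/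
structure Ops310 (g : B9.Geometry) (B : B9.Backgrounds) (X Y ι A : Type) where
  blk : X → g.Site
  blkY : Y → g.Site
  S : ι → Finset g.Site
  S' : ι → Finset g.Site
  SF : A → Finset g.Site
  h : ι → X → ℝ
  hY : ι → Y → ℝ
  KPD : ι → g.Site → g.Site → ℝ
  KCD : ι → g.Site → g.Site → ℝ
  KPL : ι → g.Site → g.Site → ℝ
  KCL : ι → g.Site → g.Site → ℝ
  KCLt : ι → g.Site → g.Site → ℝ
  G : B.Cfg → Module.End ℝ (X → ℝ)
  Δa : B.Cfg → Module.End ℝ (X → ℝ)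
  Gsq : B.Cfg → ι → Module.End ℝ (X → ℝ)
  Rf : B.Cfg → A → Module.End ℝ (X → ℝ)
  Rt : B.Cfg → A → Module.End ℝ (X → ℝ)
  D : B.Cfg → (X → ℝ) →ₗ[ℝ] (Y → ℝ)
  Dstar : B.Cfg → (Y → ℝ) →ₗ[ℝ] (X → ℝ)
  Lap : B.Cfg → Module.End ℝ (X → ℝ)
  PD : B.Cfg → ι → (Y → ℝ) →ₗ[ℝ] (Y → ℝ)
  CD : B.Cfg → ι → (X → ℝ) →ₗ[ℝ] (Y → ℝ)
  PL : B.Cfg → ι → (Y → ℝ) →ₗ[ℝ] (X → ℝ)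
  CL : B.Cfg → ι → Module.End ℝ (X → ℝ)
  CLt : B.Cfg → ι → (Y → ℝ) →ₗ[ℝ] (X → ℝ)

/-- **«From (3.108) it follows that the expansion (3.107) is convergent in all norms in the inequalities (3.42)–(3.47)»**
(p. 416) READ ON THE SUM, sup block: the operator G(U) (= the sum of (3.107), `𝔬.G U`) obeys the four inequalities (3.42)
of Theorem 3.1 *"with G′(U) replaced by G(U) and λ replaced by a function J defined at bonds"* (Theorem 3.3, p. 399) —
|(GJ)(x)|, |(∇_UGJ)(x)|, |(G∇\*_UJ)(x)|, |(Δ_UGJ)(x)| ≦ C[(L^jη)², L^jη, L^jη, 1]e^{−δd(y,y′)}|J| for x ∈ Δ(y), supp J ⊂ Δ(y′) —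
in the [4]-(2.51) majorant shapes of the lineage over the transported geometry `B9Thm34Ext.toB6 g R H` (the shapes of
`B9Thm37Whole.Conv342`).  The Hölder ∕ L² ∕ weighted members (3.43)–(3.47) are NOT part of this predicate.
[cite: Balaban1985BackgroundPropagators, Thm 3.10 p.416 + Thm 3.3 p.399 + (3.42) p.397; Balaban1984PropagatorsII, (2.51) p.232] -/
def Conv3107 (𝔬 : Ops310 g B X Y ι A) (R : ℝ) (H : Prop) (C δ : ℝ) (U : B.Cfg) : Prop :=
  HasMajorant (g := toB6 g R H) 𝔬.blk (𝔬.G U)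
      (fun (a b : g.Site) => C * g.len a ^ 2 * Real.exp (-(δ * g.dist a b))) ∧
    HasMajorantHom (g := toB6 g R H) 𝔬.blk 𝔬.blkY (𝔬.D U ∘ₗ 𝔬.G U)
      (fun (a b : g.Site) => C * g.len a * Real.exp (-(δ * g.dist a b))) ∧
    HasMajorantHom (g := toB6 g R H) 𝔬.blkY 𝔬.blk (𝔬.G U ∘ₗ 𝔬.Dstar U)
      (fun (a b : g.Site) => C * g.len a * Real.exp (-(δ * g.dist a b))) ∧
    HasMajorantHom (g := toB6 g R H) 𝔬.blk 𝔬.blk (𝔬.Lap U ∘ₗ 𝔬.G U)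
      (fun (a b : g.Site) => C * Real.exp (-(δ * g.dist a b)))

/-- **THE TWO READINGS Theorem 3.10 needs beyond the operator letters** (the Theorem 3.10 twin of
`B9Cor38Whole.WalkReading`): `ev J` = the abstract bond function J (`g.Loc`) evaluated on the lattice `X`; `Agree □ U U′` =
«U, U′ coincide on □̃⁵» (for the head factor R₀(□) = h_□G_□h_□, p. 410: *"A propagator G′_□ depends on U restricted to
Ω₀(□) ⊂ □̃⁵"*); `AgreeF a U U′` = «U, U′ coincide on X̃⁵» for the factor `a` (p. 413: *"it depends on U restricted to
X̃⁵"*).  The carrier `B9.Backgrounds.Cfg` has no restriction structure, so both relations are data.  A PARAMETER RECORD;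
nothing asserted. [cite: Balaban1985BackgroundPropagators, Thm 3.10 p.416 + p.413 + Cor. 3.8 p.410] -/
structure WalkReading310 (g : B9.Geometry) (B : B9.Backgrounds) (X ι A : Type) where
  ev : g.Loc → X → ℝ
  Agree : ι → B.Cfg → B.Cfg → Prop
  AgreeF : A → B.Cfg → B.Cfg → Prop

/-- **The reading clauses of the evaluation** (as `B9Cor38Whole.WalkReading.OK`; (3.39) ∕ (3.42) p. 397, Thm 3.3 p. 399):
supp J ⊂ Δ(y′) ⇒ `ev J` vanishes off the block of y′; |ev J| ≦ |J| pointwise; |J| ≧ 0.  A hypothesis schema.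
[cite: Balaban1985BackgroundPropagators, (3.39) + (3.42) p.397] -/
structure WalkReading310.OK (rd : WalkReading310 g B X ι A) (blk : X → g.Site) : Prop where
  off : ∀ (lam : g.Loc) (y' : g.Site), g.suppIn lam y' → ∀ x, blk x ≠ y' → rd.ev lam x = 0
  bound : ∀ (lam : g.Loc) (x : X), |rd.ev lam x| ≤ g.supNorm lam
  norm_nonneg : ∀ lam : g.Loc, 0 ≤ g.supNorm lam

/-- **The factors of the term of (3.107) indexed by ω = ((0, □₀), a₁, …, aₙ)** at U: F₀ = R₀(□₀) = h_{□₀}G_{□₀}(U)h_{□₀}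
(p. 413: *"R′₀(□) = h_□C_□h_□"* for (3.98); here with G_□), Fᵢ = R_{aᵢ}(U) = `𝔬.Rf U (a i)` (i ≧ 1); the term is
`B9Thm37Sum.lprod` of these. [cite: Balaban1985BackgroundPropagators, (3.107) p.416 + p.413] -/
def walkOps310 (𝔬 : Ops310 g B X Y ι A) (U : B.Cfg) (q : ι) (a : ℕ → A) (k : ℕ) : Module.End ℝ (X → ℝ) :=
  if k = 0 then mulOp (𝔬.h q) * 𝔬.Gsq U q * mulOp (𝔬.h q) else 𝔬.Rf U (a k)

omit [Fintype g.Site] [DecidableEq g.Site] in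
/-- The supports along the walk: S_{□₀} for the head factor, X_i ∩ 𝔅 = `SF (a i)` for the factors R_{a_i} — the sets over
which (3.93) takes its infimum (p. 413: *"the infimum is taken over yᵢ ∈ Xᵢ ∩ 𝔅"*).
[cite: Balaban1985BackgroundPropagators, (3.93) p.410 + (3.99) p.413] -/
def walkSets310 (𝔬 : Ops310 g B X Y ι A) (q : ι) (a : ℕ → A) (k : ℕ) : Finset g.Site :=
  if k = 0 then 𝔬.S q else 𝔬.SF (a k)

omit [Fintype g.Site] [DecidableEq g.Site] in
/-- Left-nested products only read their first n + 1 factors: equal factors give equal products. [folklore] -/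
private theorem lprod_congr {F F' : ℕ → Module.End ℝ (X → ℝ)} :
    ∀ (n : ℕ), (∀ k, k ≤ n → F k = F' k) → lprod F n = lprod F' n := by
  intro n
  induction n generalizing F F' with
  | zero => intro hF; exact hF 0 le_rfl
  | succ n ih =>
      intro hF
      show F 0 * lprod (fun i => F (i + 1)) n = F' 0 * lprod (fun i => F' (i + 1)) n
      rw [hF 0 (Nat.zero_le _), ih (fun k hk => hF (k + 1) (by omega))]

omit [Fintype g.Site] [DecidableEq g.Site] in
/-- A nonnegative pointwise bound on the block bounds the block sup `B9Cor38Whole.blkSup` (`Real.iSup_le`). [folklore] -/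
private theorem blkSup_le' (blk : X → g.Site) {f : X → ℝ} {y : g.Site} {c : ℝ} (hc : 0 ≤ c)
    (hf : ∀ x, blk x = y → f x ≤ c) : blkSup blk f y ≤ c :=
  Real.iSup_le (fun x => hf x.1 x.2) hc

/-- ★ **THE EXPANSION DATUM OF THEOREM 3.10 WITH EVERY FIELD PINNED.**  `Walk` = triples (n, □₀, a) reading the printed walk
((0, X₀), (α₁, X₁), …, (αₙ, Xₙ)) with X₀ = □₀ and (αᵢ, Xᵢ) = a i (i = 1, …, n); `wlen` = |ω| = n; `first ω y` = y ∈ S_{□₀}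
(print: x ∈ Δ(y), y ∈ Λ_j, the head factor localized at □₀); `last ω y′` = y′ ∈ Xₙ ∩ 𝔅 (= S_{□₀} when n = 0; print: supp J ⊂
Δ(y′)); `wdist` = d(ω, y, y′) of (3.93) over X₁ ∩ 𝔅, …, Xₙ ∩ 𝔅 (`B9Cor38Whole.minLen`); `term U ω J y` = |Δ(y)R₀(X₀)R_{α₁}(X₁)⋯
R_{αₙ}(Xₙ)J| read as the block sup of the lattice function `lprod (walkOps310 𝔬 U □₀ a) n (ev J)`; `LocDep U ω` = «the term
operator at U equals the one at every U′ coinciding with U on □̃⁵₀, X̃⁵₁, …, X̃⁵ₙ»; `Converges U` := `Conv U` — the convergence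
predicate is a PARAMETER (sup-block pin: `Conv3107 𝔬 R H C δ`; all-blocks pin: the sibling `B9RWSums343to347Whole`).
[cite: Balaban1985BackgroundPropagators, Thm 3.10 (3.107)–(3.108) pp.415–416 + (3.93) p.410] -/
def W310OfOps (𝔬 : Ops310 g B X Y ι A) (rd : WalkReading310 g B X ι A) (Conv : B.Cfg → Prop) :
    B9.RWExpansion g B where
  Walk := ℕ × ι × (ℕ → A)
  wlen w := w.1
  first w y := y ∈ 𝔬.S w.2.1
  last w y' := y' ∈ walkSets310 𝔬 w.2.1 w.2.2 w.1
  wdist w y y' := minLen g.dist (walkSets310 𝔬 w.2.1 w.2.2) w.1 y y'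
  term U w lam y := blkSup 𝔬.blk (fun x => |lprod (walkOps310 𝔬 U w.2.1 w.2.2) w.1 (rd.ev lam) x|) y
  LocDep U w := ∀ U' : B.Cfg, rd.Agree w.2.1 U U' → (∀ k, 1 ≤ k → k ≤ w.1 → rd.AgreeF (w.2.2 k) U U') →
    lprod (walkOps310 𝔬 U w.2.1 w.2.2) w.1 = lprod (walkOps310 𝔬 U' w.2.1 w.2.2) w.1
  Converges U := Conv U

omit [Fintype g.Site] [DecidableEq g.Site] in
/-- The convergence predicate of `W310OfOps 𝔬 rd Conv` IS `Conv` (by `Iff.rfl`) — at the sup-block pin `Conv := Conv3107 𝔬 R H C δ`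
the typed reading of *"the expansion (3.107) is convergent in all norms in the inequalities (3.42)"*, the shape the summation
leaf `B9.RWSumsYieldIneqs` consumes through an implication `Converges → …`; an all-blocks pin conjoins the Hölder ∕ L² ∕
weighted members (sibling `B9RWSums343to347Whole`). [cite: Balaban1985BackgroundPropagators, Thm 3.10 p.416] -/
theorem converges_W310OfOps (𝔬 : Ops310 g B X Y ι A) (rd : WalkReading310 g B X ι A) (Conv : B.Cfg → Prop)
    (U : B.Cfg) : (W310OfOps 𝔬 rd Conv).Converges U ↔ Conv U :=
  Iff.rfl

omit [Fintype g.Site] [DecidableEq g.Site] in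
/-- `W310OfOps` reads the term length as |ω| = n (by `rfl`). [cite: Balaban1985BackgroundPropagators, Thm 3.10 p.416] -/
theorem wlen_W310OfOps (𝔬 : Ops310 g B X Y ι A) (rd : WalkReading310 g B X ι A) (Conv : B.Cfg → Prop)
    (w : ℕ × ι × (ℕ → A)) : (W310OfOps 𝔬 rd Conv).wlen w = w.1 :=
  rfl

omit [Fintype g.Site] [DecidableEq g.Site] in
/-- The walk readings of `W310OfOps` (walks, length, ends, distance, term, localisation) do not depend on the convergence
predicate (by `rfl`): two pins differ only in `Converges`. [cite: Balaban1985BackgroundPropagators, Thm 3.10 (3.107)–(3.108) p.416] -/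
theorem W310OfOps_congr_conv (𝔬 : Ops310 g B X Y ι A) (rd : WalkReading310 g B X ι A) (Conv Conv' : B.Cfg → Prop) :
    W310OfOps 𝔬 rd Conv' = { W310OfOps 𝔬 rd Conv with Converges := Conv' } :=
  rfl

/-! ## §2 The hypothesis schemas (printed shape; nothing asserted) -/

/-- **The SIZES of the Leibniz coefficient kernels** at one member: `kPD`, `kCD` ∕ `kPL`, `kCL` = the row sums of the kernels
of the Leibniz letters of ∇_U (weight L^jη) ∕ Δ_U (weight 1) through M_{h_□}; `kCLt` = the column sum of the right Leibniz
letter of ∇\*_U.  Print: ∂h_□ = O((ML^jη)⁻¹), Δh_□ = O((ML^jη)⁻²) for the partition of unity of [4] Sect. A ((1.118)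
[`Balaban1984PropagatorsI`], (3.100) p. 413: *"They are of the order O(M⁻¹), or O(M⁻²), if considered on a proper scale"*)
— the sizes are NOT displayed in print (cell GAPS G-pv21g4-1 (i)); free letters (the Theorem 3.10 part of
`B9Thm37Whole.Sizes`). [cite: Balaban1985BackgroundPropagators, (3.100) pp.413–414 + (3.88) p.409; Balaban1984PropagatorsII, (2.39)–(2.44) pp.229–230] -/
structure Sizes310 where
  kPD : ℝ
  kCD : ℝ
  kPL : ℝ
  kCL : ℝ
  kCLt : ℝ

/-- All five sizes are nonnegative. [cite: Balaban1984PropagatorsII, (2.39)–(2.44) pp.229–230] -/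
structure Sizes310.Nonneg (κ : Sizes310) : Prop where
  kPD : 0 ≤ κ.kPD
  kCD : 0 ≤ κ.kCD
  kPL : 0 ≤ κ.kPL
  kCL : 0 ≤ κ.kCL
  kCLt : 0 ≤ κ.kCLt

/-- The Leibniz sizes are bounded by one letter K (they enter the constant of the leaf, not the smallness).
[cite: Balaban1985BackgroundPropagators, (3.100) pp.413–414; Balaban1984PropagatorsII, (2.44) p.230] -/
structure Sizes310.Bounded (κ : Sizes310) (K : ℝ) : Prop where
  nonneg : κ.Nonneg
  leibD : κ.kPD + κ.kCD ≤ K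
  leibL : κ.kPL + κ.kCL ≤ K
  leibT : κ.kCLt ≤ K

/-- **THE STATIC DATA AT ONE MEMBER** (independent of U; the Theorem 3.10 part of `B9Thm37Whole.StaticOK` plus the factor
count): the multiscale distance d of [4] (2.46) is a pseudo-metric ((2.54), d(y, y) = 0, symmetry, d ≧ 0) and L^jη > 0; the
partition of unity has |h_□| ≦ 1 with supp h_□ within the blocks of S_□ (on `X` and on `Y`); every block meets at most N of
the S_□, N′ of the S′_□ and N_F of the factor localizations X ∩ 𝔅 (p. 413: *"We consider only very small families,
containing several cubes"*; cell GAPS G-B9-22); the scales on S_□ × S′_□ are comparable, L^jη ≦ C_ℓL^{j′}η; each Leibniz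
coefficient kernel is ≧ 0, of range ≦ ρ, with the row (resp. column) sums of `Sizes310`.  Hypotheses of the lineage
theorems, bundled; nothing asserted.
[cite: Balaban1985BackgroundPropagators, (3.87)–(3.89) pp.408–409 + p.413; Balaban1984PropagatorsII, (2.46) p.231, (2.54) p.233, (2.39)–(2.44) pp.229–230] -/
structure StaticOK310 [Fintype ι] [Fintype A] (𝔬 : Ops310 g B X Y ι A) (ρ N N' NF Cℓ : ℝ) (κ : Sizes310) : Prop where
  tri : ∀ a b c : g.Site, g.dist a c ≤ g.dist a b + g.dist b c
  refl : ∀ y : g.Site, g.dist y y = 0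
  symm : ∀ y y' : g.Site, g.dist y y' = g.dist y' y
  dnn : ∀ y y' : g.Site, 0 ≤ g.dist y y'
  lenpos : ∀ y : g.Site, 0 < g.len y
  hh : ∀ i x, |𝔬.h i x| ≤ 1
  hS : ∀ i x, 𝔬.h i x ≠ 0 → 𝔬.blk x ∈ 𝔬.S i
  hhY : ∀ i v, |𝔬.hY i v| ≤ 1
  hSY : ∀ i v, 𝔬.hY i v ≠ 0 → 𝔬.blkY v ∈ 𝔬.S i
  cnt : ∀ a : g.Site, (∑ i, if a ∈ 𝔬.S i then (1 : ℝ) else 0) ≤ N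
  cnt' : ∀ a : g.Site, (∑ i, if a ∈ 𝔬.S' i then (1 : ℝ) else 0) ≤ N'
  cntF : ∀ a : g.Site, (∑ q, if a ∈ 𝔬.SF q then (1 : ℝ) else 0) ≤ NF
  comp : ∀ i (a b : g.Site), a ∈ 𝔬.S i → b ∈ 𝔬.S' i → g.len a ≤ Cℓ * g.len b
  KPD_nonneg : ∀ i a b, 0 ≤ 𝔬.KPD i a b
  KPD_loc : ∀ i a y'', 𝔬.KPD i a y'' ≠ 0 → g.dist a y'' ≤ ρ
  KPD_row : ∀ i (a : g.Site), ∑ y'' : g.Site, 𝔬.KPD i a y'' * g.len y'' ≤ if a ∈ 𝔬.S' i then κ.kPD * g.len a else 0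
  KCD_nonneg : ∀ i a b, 0 ≤ 𝔬.KCD i a b
  KCD_loc : ∀ i a y'', 𝔬.KCD i a y'' ≠ 0 → g.dist a y'' ≤ ρ
  KCD_row : ∀ i (a : g.Site),
    ∑ y'' : g.Site, 𝔬.KCD i a y'' * g.len y'' ^ 2 ≤ if a ∈ 𝔬.S' i then κ.kCD * g.len a else 0
  KPL_nonneg : ∀ i a b, 0 ≤ 𝔬.KPL i a b
  KPL_loc : ∀ i a y'', 𝔬.KPL i a y'' ≠ 0 → g.dist a y'' ≤ ρ
  KPL_row : ∀ i (a : g.Site), ∑ y'' : g.Site, 𝔬.KPL i a y'' * g.len y'' ≤ if a ∈ 𝔬.S' i then κ.kPL else 0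
  KCL_nonneg : ∀ i a b, 0 ≤ 𝔬.KCL i a b
  KCL_loc : ∀ i a y'', 𝔬.KCL i a y'' ≠ 0 → g.dist a y'' ≤ ρ
  KCL_row : ∀ i (a : g.Site), ∑ y'' : g.Site, 𝔬.KCL i a y'' * g.len y'' ^ 2 ≤ if a ∈ 𝔬.S' i then κ.kCL else 0
  KCLt_nonneg : ∀ i a b, 0 ≤ 𝔬.KCLt i a b
  KCLt_loc : ∀ i y'' b, 𝔬.KCLt i y'' b ≠ 0 → g.dist y'' b ≤ ρ
  KCLt_col : ∀ i (b : g.Site), (∑ y'' : g.Site, 𝔬.KCLt i y'' b) * g.len b ≤ if b ∈ 𝔬.S' i then κ.kCLt else 0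

/-- **«THE OPERATORS G_□(U) SATISFY ALL THE INEQUALITIES OF THEOREMS 3.1–3.3»** (p. 409; Corollary 3.6 holding for the local
sequences {Ω_n(□)}, □ ∈ 𝒟) at the configuration U, in the lineage's shapes — entries 1, 2, 3, 4 of (3.42) for every G_□(U)
(Theorem 3.3's reading: G′ ↦ G, λ ↦ J) with one pair (B₀, δ₀): the legs of the expansion.  (From the cell's typed
`B9.Cor36Printed` they follow by `local342G_of_cor36Printed` below under a `Realizes` reading.)  A HYPOTHESIS SCHEMA;
Corollary 3.6 is not asserted. [cite: Balaban1985BackgroundPropagators, Cor. 3.6 p.408 + p.409 + (3.42) p.397 + Thm 3.3 p.399] -/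
structure Local342G (𝔬 : Ops310 g B X Y ι A) (R : ℝ) (H : Prop) (B₀ δ₀ : ℝ) (U : B.Cfg) : Prop where
  e0 : ∀ i, HasMajorant (g := toB6 g R H) 𝔬.blk (𝔬.Gsq U i)
    (fun (a b : g.Site) => B₀ * g.len a ^ 2 * Real.exp (-(δ₀ * g.dist a b)))
  e1 : ∀ i, HasMajorantHom (g := toB6 g R H) 𝔬.blk 𝔬.blkY (𝔬.D U ∘ₗ 𝔬.Gsq U i)
    (fun (a b : g.Site) => B₀ * g.len a * Real.exp (-(δ₀ * g.dist a b)))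
  e2 : ∀ i, HasMajorantHom (g := toB6 g R H) 𝔬.blkY 𝔬.blk (𝔬.Gsq U i ∘ₗ 𝔬.Dstar U)
    (fun (a b : g.Site) => B₀ * g.len a * Real.exp (-(δ₀ * g.dist a b)))
  e3 : ∀ i, HasMajorantHom (g := toB6 g R H) 𝔬.blk 𝔬.blk (𝔬.Lap U ∘ₗ 𝔬.Gsq U i)
    (fun (a b : g.Site) => B₀ * Real.exp (-(δ₀ * g.dist a b)))

/-- **THE (3.89)-TYPE BOUNDS OF THE ELEMENTARY FACTORS** at the configuration U (p. 413: *"An operator R_α(X) … is localized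
in X, … and satisfies a bound of the type (3.89), possibly with an additional power of L^jη"*; p. 414: *"it will follow from
this analysis that R satisfies the bound (3.85) with O(M⁻¹) instead of O(α₁)"*; (3.89) p. 409: *"|(K(h_□)G′_□h_□λ)(x)| ≦
O(M⁻¹)e^{−δ₀(L^jη)⁻¹|y−y′|}|λ|"*), with O(M⁻¹) = θ₀M⁻¹ and the multiscale d in the exponent (as in the lineage, [4] (2.51)):
`fac` — R_a(U) has the block-sup majorant 1_{X∩𝔅}(y)·θ₀M⁻¹·e^{−δ₀d(y,y′)}; `facT` — the transposed factor R♯_a(U) has the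
scale-weighted majorant 1_{X∩𝔅}(y′)·θ₀M⁻¹·(L^jη)(L^{j′}η)⁻¹·e^{−δ₀d(y,y′)} (the *"additional power of L^jη"*; the shape of
`B9Thm37Glue.rightR_cube_majorant`).  The smallness of the four families of pieces of R in (3.105) — K(h_□)G_□h_□ by (3.89),
(1 − ζ_□̃)DPD\*h_□G_□h_□ by the separation ≧ M, the differences of (3.97) type, the commutator terms of p. 415 — is proved in
print by reference to [4] Prop. 2.2 ∕ (2.135) and a sketch (cell GAPS G-B9-05, G-B9-06a, G-B9-07); it is NOT proved here.
A HYPOTHESIS SCHEMA. [cite: Balaban1985BackgroundPropagators, p.413 + (3.105) p.414 + (3.89) p.409 + (3.85) p.407; Balaban1984PropagatorsII, Prop. 2.2 (2.51) p.232] -/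
structure Factors389 (𝔬 : Ops310 g B X Y ι A) (R : ℝ) (H : Prop) (θ₀ δ₀ : ℝ) (U : B.Cfg) : Prop where
  fac : ∀ a : A, HasMajorant (g := toB6 g R H) 𝔬.blk (𝔬.Rf U a)
    (fun (y y' : g.Site) => if y ∈ 𝔬.SF a then θ₀ * g.M⁻¹ * Real.exp (-(δ₀ * g.dist y y')) else 0)
  facT : ∀ a : A, HasMajorant (g := toB6 g R H) 𝔬.blk (𝔬.Rt U a)
    (fun (y y' : g.Site) => (if y' ∈ 𝔬.SF a then (1 : ℝ) else 0) * (θ₀ * g.M⁻¹) * (g.len y * (g.len y')⁻¹) *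
      Real.exp (-(δ₀ * g.dist y y')))

omit [DecidableEq g.Site] in
/-- Rates merge downwards: the Cor. 3.6 legs at rate δ₀ are legs at every rate δ ≦ δ₀ (d ≧ 0, B₀ ≧ 0, L^jη ≧ 0). [folklore] -/
private theorem Local342G.of_rate_le {𝔬 : Ops310 g B X Y ι A} {R : ℝ} {H : Prop} {B₀ δ₀ δ : ℝ} {U : B.Cfg}
    (h : Local342G 𝔬 R H B₀ δ₀ U) (hB₀ : 0 ≤ B₀) (hδ : δ ≤ δ₀) (hdnn : ∀ y y' : g.Site, 0 ≤ g.dist y y')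
    (hlen : ∀ y : g.Site, 0 ≤ g.len y) : Local342G 𝔬 R H B₀ δ U := by
  have hexp : ∀ a b : g.Site, Real.exp (-(δ₀ * g.dist a b)) ≤ Real.exp (-(δ * g.dist a b)) := fun a b =>
    Real.exp_le_exp.2 (neg_le_neg (mul_le_mul_of_nonneg_right hδ (hdnn a b)))
  refine ⟨fun i => hasMajorant_mono (g := toB6 g R H) 𝔬.blk (h.e0 i) fun a b => ?_,
    fun i => hasMajorantHom_mono (g := toB6 g R H) 𝔬.blk 𝔬.blkY (h.e1 i) fun a b => ?_,
    fun i => hasMajorantHom_mono (g := toB6 g R H) 𝔬.blkY 𝔬.blk (h.e2 i) fun a b => ?_,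
    fun i => hasMajorantHom_mono (g := toB6 g R H) 𝔬.blk 𝔬.blk (h.e3 i) fun a b => ?_⟩
  · exact mul_le_mul_of_nonneg_left (hexp a b) (mul_nonneg hB₀ (sq_nonneg _))
  · exact mul_le_mul_of_nonneg_left (hexp a b) (mul_nonneg hB₀ (hlen a))
  · exact mul_le_mul_of_nonneg_left (hexp a b) (mul_nonneg hB₀ (hlen a))
  · exact mul_le_mul_of_nonneg_left (hexp a b) hB₀

/-- Rates merge downwards for the factor bounds as well (d ≧ 0, θ₀M⁻¹ ≧ 0, L^jη ≧ 0). [folklore] -/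
private theorem Factors389.of_rate_le {𝔬 : Ops310 g B X Y ι A} {R : ℝ} {H : Prop} {θ₀ δ₀ δ : ℝ} {U : B.Cfg}
    (h : Factors389 𝔬 R H θ₀ δ₀ U) (hθ : 0 ≤ θ₀ * g.M⁻¹) (hδ : δ ≤ δ₀) (hdnn : ∀ y y' : g.Site, 0 ≤ g.dist y y')
    (hlen : ∀ y : g.Site, 0 ≤ g.len y) : Factors389 𝔬 R H θ₀ δ U := by
  have hexp : ∀ a b : g.Site, Real.exp (-(δ₀ * g.dist a b)) ≤ Real.exp (-(δ * g.dist a b)) := fun a b =>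
    Real.exp_le_exp.2 (neg_le_neg (mul_le_mul_of_nonneg_right hδ (hdnn a b)))
  refine ⟨fun q => hasMajorant_mono (g := toB6 g R H) 𝔬.blk (h.fac q) fun a b => ?_,
    fun q => hasMajorant_mono (g := toB6 g R H) 𝔬.blk (h.facT q) fun a b => ?_⟩
  · split_ifs
    · exact mul_le_mul_of_nonneg_left (hexp a b) hθ
    · exact le_rfl
  · refine mul_le_mul_of_nonneg_left (hexp a b) (mul_nonneg (mul_nonneg ?_ hθ) (mul_nonneg (hlen a) ?_))
    · split_ifs <;> norm_num
    · exact inv_nonneg.mpr (hlen b)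

/-- **THE ALGEBRAIC STRUCTURE OF THE EXPANSION AT U** (hypotheses of the lineage, bundled): the Leibniz letters are majorised by
their kernels (`hPD … hCLt`); the Leibniz rules of ∇_U, Δ_U through M_{h_□} ((3.100), first line of (3.88)) and the right
Leibniz rule of ∇\*_U (*"similarly for adjoint derivatives"*, p. 413); GΔ_a = I and Δ_aG = I (G = Δ_a⁻¹, (3.27) and Theorem
3.11); **(3.105)** *"Δ_aG₀ = I − R"* with G₀ = Σ_□h_□G_□h_□ ((3.87)) and R = Σ_a R_a after the substitutions of p. 415
(`eq3105`), and its transpose G₀Δ_a = I − Σ_a R♯_a (`eq3105T`; in print Δ_a and G₀ are symmetric, so R♯ = Rᵀ).  Nothing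
asserted. [cite: Balaban1985BackgroundPropagators, (3.105)–(3.106) p.414 + (3.87) p.409 + (3.100) p.413 + (3.27) p.395] -/
structure Identities310 [Fintype A] [Fintype ι] (𝔬 : Ops310 g B X Y ι A) (R : ℝ) (H : Prop) (U : B.Cfg) : Prop where
  hPD : ∀ i, HasMajorantHom (g := toB6 g R H) 𝔬.blkY 𝔬.blkY (𝔬.PD U i) (𝔬.KPD i)
  hCD : ∀ i, HasMajorantHom (g := toB6 g R H) 𝔬.blk 𝔬.blkY (𝔬.CD U i) (𝔬.KCD i)
  hPL : ∀ i, HasMajorantHom (g := toB6 g R H) 𝔬.blkY 𝔬.blk (𝔬.PL U i) (𝔬.KPL i)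
  hCL : ∀ i, HasMajorantHom (g := toB6 g R H) 𝔬.blk 𝔬.blk (𝔬.CL U i) (𝔬.KCL i)
  hCLt : ∀ i, HasMajorantHom (g := toB6 g R H) 𝔬.blkY 𝔬.blk (𝔬.CLt U i) (𝔬.KCLt i)
  leibD : ∀ i, 𝔬.D U ∘ₗ mulOp (𝔬.h i) = mulOp (𝔬.hY i) ∘ₗ 𝔬.D U + (𝔬.PD U i ∘ₗ 𝔬.D U + 𝔬.CD U i)
  leibL : ∀ i, 𝔬.Lap U ∘ₗ mulOp (𝔬.h i) = mulOp (𝔬.h i) ∘ₗ 𝔬.Lap U + (𝔬.PL U i ∘ₗ 𝔬.D U + 𝔬.CL U i)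
  leibT : ∀ i, mulOp (𝔬.h i) ∘ₗ 𝔬.Dstar U = 𝔬.Dstar U ∘ₗ mulOp (𝔬.hY i) + 𝔬.CLt U i
  inv : 𝔬.G U * 𝔬.Δa U = 1
  invT : 𝔬.Δa U * 𝔬.G U = 1
  eq3105 : 𝔬.Δa U * (∑ i, mulOp (𝔬.h i) * 𝔬.Gsq U i * mulOp (𝔬.h i)) = 1 - ∑ a, 𝔬.Rf U a
  eq3105T : (∑ i, mulOp (𝔬.h i) * 𝔬.Gsq U i * mulOp (𝔬.h i)) * 𝔬.Δa U = 1 - ∑ a, 𝔬.Rt U a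

/-- **THE TWO PRINTED LOCALITY INPUTS** as a hypothesis schema on the letters: the head factor h_□G_□(U)h_□ coincides at
configurations coinciding on □̃⁵ (p. 410: *"A propagator G′_□ depends on U restricted to Ω₀(□) ⊂ □̃⁵"*, the same for G_□),
and each factor R_α(X)(U) coincides at configurations coinciding on X̃⁵ (p. 413: *"it depends on U restricted to X̃⁵"*).
Nothing asserted. [cite: Balaban1985BackgroundPropagators, p.413 + Cor. 3.8 p.410 + Thm 3.10 p.416] -/
structure Locality310 (𝔬 : Ops310 g B X Y ι A) (rd : WalkReading310 g B X ι A) : Prop where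
  gsq : ∀ (q : ι) (U U' : B.Cfg), rd.Agree q U U' →
    mulOp (𝔬.h q) * 𝔬.Gsq U q * mulOp (𝔬.h q) = mulOp (𝔬.h q) * 𝔬.Gsq U' q * mulOp (𝔬.h q)
  fac : ∀ (a : A) (U U' : B.Cfg), rd.AgreeF a U U' → 𝔬.Rf U a = 𝔬.Rf U' a


/-! ## §3 Theorem 3.10 at one member and one U; the bound (3.108) -/

omit [Fintype g.Site] [DecidableEq g.Site] in
/-- Arithmetic of «M sufficiently large»: a constant A(1 − q)⁻¹ with q ≦ ½ and A ≦ A′ is ≦ 2A′, against nonnegative weights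
and a larger exponential factor (verbatim twin of the private lemma of `B9Thm37Whole`). [folklore] -/
private theorem weaken {A A' q w e e' : ℝ} (hA : 0 ≤ A) (hAA' : A ≤ A') (hq : q ≤ 1 / 2) (hw : 0 ≤ w) (he : 0 ≤ e)
    (hee' : e ≤ e') : A * (1 - q)⁻¹ * w * e ≤ 2 * A' * w * e' := by
  have hinv : (1 - q)⁻¹ ≤ 2 := by
    rw [inv_le_comm₀ (by linarith) (by norm_num : (0 : ℝ) < 2)]
    linarith
  have h1 : A * (1 - q)⁻¹ ≤ 2 * A' :=
    calc A * (1 - q)⁻¹ ≤ A * 2 := mul_le_mul_of_nonneg_left hinv hA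
      _ ≤ A' * 2 := mul_le_mul_of_nonneg_right hAA' (by norm_num)
      _ = 2 * A' := by ring
  have hA' : 0 ≤ 2 * A' := by linarith
  calc A * (1 - q)⁻¹ * w * e = (A * (1 - q)⁻¹) * (w * e) := by ring
    _ ≤ (2 * A') * (w * e') :=
        mul_le_mul h1 (mul_le_mul_of_nonneg_left hee' hw) (mul_nonneg hw he) hA'
    _ = 2 * A' * w * e' := by ring

omit [Fintype g.Site] [DecidableEq g.Site] in
/-- Monotonicity of the entry constants B₀(N + N′e^{δ₀ρ}s)c₁ in the size letter s. [folklore] -/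
private theorem constA_le {B₀ N N' ex s t c : ℝ} (hB₀ : 0 ≤ B₀) (hN'e : 0 ≤ N' * ex) (hc : 0 ≤ c) (hst : s ≤ t) :
    B₀ * (N + N' * ex * s) * c ≤ B₀ * (N + N' * ex * t) * c := by
  have h1 : N' * ex * s ≤ N' * ex * t := mul_le_mul_of_nonneg_left hst hN'e
  have h2 : N + N' * ex * s ≤ N + N' * ex * t := by linarith
  exact mul_le_mul_of_nonneg_right (mul_le_mul_of_nonneg_left h2 hB₀) hc

/-- **THEOREM 3.10 AT ONE MEMBER AND ONE CONFIGURATION U — the four entries of (3.42) for the sum G(U) of (3.107) with ONE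
pair of constants** (C = `B9Thm37Whole.const37 d δ₀ α ρ B₀ N N' Cℓ K` = 2B₀(N + N′e^{δ₀ρ}C_ℓK)c₁(α), δ = (1 − 2α)δ₀), glued
from the lineage: G = G₀ + GR (`B9Thm37Sum.fixedPoint_of_388` on `GΔ_a = I`, (3.105)) resp. G = G₀ + R♯G (the transposed
(3.105), `B9Thm37Glue.fixedPoint_of_388T`); entry 1 by `B6RandomWalk.majorant_of_fixedPoint_266` over the localized legs
h_□G_□h_□ (`B9Thm37Sum.hasMajorant_sandwich_local`); entries 2, 4 by `B6RandomWalkHom.hom_majorant_of_fixedPoint_266` over the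
legs `B9Thm37Glue.leftEntry_cube_majorant` (E = ∇_U, W = L^jη; E = Δ_U, W ≡ 1); entry 3 by
`B6RandomWalkHom.hom_majorant_of_leftFixedPoint_weighted` over `B9Thm37Glue.rightEntry_cube_majorant` and the scale-weighted
transposed factors; the factors summed with the overlap count N_F (`B9Thm37Sum.hasMajorant_localSum`).  Inputs: «Cor. 3.6 for
all G_□(U)» (`Local342G`), the (3.89)-type factor bounds (`Factors389`), the structure (`Identities310`), the static data
(`StaticOK310`), [4] Lemma 2.1 (2.61) at the exponent α, and «M sufficiently large» LOCATED as N_F·θ₀M⁻¹·c₁(α) ≦ ½ with the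
Leibniz sizes ≦ K (C_ℓ ≧ 1, 0 ≦ α ≦ ½).  p. 416: *"From (3.108) it follows that the expansion (3.107) is convergent in all
norms in the inequalities (3.42)–(3.47)."* [cite: Balaban1985BackgroundPropagators, Thm 3.10 (3.105)–(3.108) pp.414–416 + (3.42) p.397; Balaban1984PropagatorsII, Prop 2.2 (2.64)–(2.67) p.234] -/
theorem conv3107_of_local3107 [Fintype X] [DecidableEq X] [Fintype Y] [DecidableEq Y] [Fintype ι] [Fintype A]
    (𝔬 : Ops310 g B X Y ι A) (R : ℝ) (H : Prop) (d : ℕ) (δ₀ α ρ B₀ N N' NF Cℓ K θ₀ : ℝ) (κ : Sizes310) (U : B.Cfg)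
    (hB₀ : 0 ≤ B₀) (hδ₀ : 0 ≤ δ₀) (hα : 0 ≤ α) (hα2 : α ≤ 1 / 2) (hN : 0 ≤ N) (hN' : 0 ≤ N') (hNF : 0 ≤ NF)
    (hCℓ : 1 ≤ Cℓ) (hK : 0 ≤ K) (hθ₀ : 0 ≤ θ₀) (hM : 0 < g.M) (hs : StaticOK310 𝔬 ρ N N' NF Cℓ κ) (hκ : κ.Bounded K)
    (h261 : Ineq261 d (toB6 g R H) δ₀ α) (hq : NF * (θ₀ * g.M⁻¹) * B6.c1 d δ₀ α ≤ 1 / 2)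
    (hl : Local342G 𝔬 R H B₀ δ₀ U) (hf : Factors389 𝔬 R H θ₀ δ₀ U) (hi : Identities310 𝔬 R H U) :
    Conv3107 𝔬 R H (const37 d δ₀ α ρ B₀ N N' Cℓ K) ((1 - 2 * α) * δ₀) U := by
  have hlen : ∀ y : g.Site, 0 ≤ g.len y := fun y => (hs.lenpos y).le
  have h1αδ : 0 ≤ (1 - α) * δ₀ := mul_nonneg (by linarith) hδ₀
  have hαδ : 0 ≤ α * δ₀ := mul_nonneg hα hδ₀
  have hαδ2 : 0 ≤ (1 - 2 * α) * δ₀ := mul_nonneg (by linarith) hδ₀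
  have htri : Triangle254 (toB6 g R H) := fun a b c => hs.tri a b c
  have h263 : Ineq263 d (toB6 g R H) δ₀ α := ineq263_of_261 d (toB6 g R H) δ₀ α htri hδ₀ (by linarith) h261
  have hc1 : 0 ≤ B6.c1 d δ₀ α := c1_nonneg d δ₀ α
  have hCℓ0 : 0 ≤ Cℓ := le_trans zero_le_one hCℓ
  have hθ : 0 ≤ NF * (θ₀ * g.M⁻¹) := mul_nonneg hNF (mul_nonneg hθ₀ (inv_nonneg.mpr hM.le))
  have hθM : 0 ≤ θ₀ * g.M⁻¹ := mul_nonneg hθ₀ (inv_nonneg.mpr hM.le)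
  have hsmall : NF * (θ₀ * g.M⁻¹) * B6.c1 d δ₀ α < 1 := by linarith
  have hN'e : 0 ≤ N' * Real.exp (δ₀ * ρ) := mul_nonneg hN' (Real.exp_nonneg _)
  have hkD : 0 ≤ κ.kPD + κ.kCD := add_nonneg hκ.nonneg.kPD hκ.nonneg.kCD
  have hkL : 0 ≤ κ.kPL + κ.kCL := add_nonneg hκ.nonneg.kPL hκ.nonneg.kCL
  have hKCℓ : K ≤ Cℓ * K := by
    calc K = 1 * K := (one_mul K).symm
      _ ≤ Cℓ * K := mul_le_mul_of_nonneg_right hCℓ hK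
  have hexp : ∀ a b : g.Site, Real.exp (-((1 - α) * δ₀ * g.dist a b)) ≤ Real.exp (-((1 - 2 * α) * δ₀ * g.dist a b)) := by
    intro a b
    have h0 : 0 ≤ α * δ₀ * g.dist a b := mul_nonneg hαδ (hs.dnn a b)
    exact Real.exp_le_exp.mpr (by nlinarith [h0])
  have hfin : ∀ w e' : ℝ, 2 * (B₀ * (N + N' * Real.exp (δ₀ * ρ) * (Cℓ * K)) * B6.c1 d δ₀ α) * w * e' =
      const37 d δ₀ α ρ B₀ N N' Cℓ K * w * e' := by
    intro w e'
    simp only [const37]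
    ring
  -- R = Σ_a R_a has majorant N_F·θ₀M⁻¹·e^{−δ₀d} (the factor bounds summed with the overlap count N_F)
  have hRa : ∀ a : A, HasMajorant (g := toB6 g R H) 𝔬.blk (𝔬.Rf U a)
      (fun (y y' : g.Site) => (if y ∈ 𝔬.SF a then (1 : ℝ) else 0) * (θ₀ * g.M⁻¹ * Real.exp (-(δ₀ * g.dist y y')))) :=
    fun a => hasMajorant_mono (g := toB6 g R H) 𝔬.blk (hf.fac a) fun y y' => le_of_eq (by split_ifs <;> simp)
  have hR : HasMajorant (g := toB6 g R H) 𝔬.blk (∑ a, 𝔬.Rf U a)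
      (fun (y y' : g.Site) => NF * (θ₀ * g.M⁻¹) * Real.exp (-(δ₀ * g.dist y y'))) := by
    have hloc := hasMajorant_localSum (G := toB6 g R H) 𝔬.blk (fun a => 𝔬.Rf U a)
      (fun a (y : g.Site) => if y ∈ 𝔬.SF a then (1 : ℝ) else 0)
      (fun (y y' : g.Site) => θ₀ * g.M⁻¹ * Real.exp (-(δ₀ * g.dist y y'))) NF
      (fun y y' => mul_nonneg hθM (Real.exp_nonneg _)) hRa hs.cntF
    exact hasMajorant_mono (g := toB6 g R H) 𝔬.blk hloc fun y y' => le_of_eq (by ring)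
  -- (3.106): G = G₀ + GR from GΔ_a = I and (3.105)
  have hfix : 𝔬.G U = (∑ i, mulOp (𝔬.h i) * 𝔬.Gsq U i * mulOp (𝔬.h i)) + 𝔬.G U * ∑ a, 𝔬.Rf U a :=
    fixedPoint_of_388 hi.inv hi.eq3105
  -- entry 1: the head terms h_□G_□h_□ localized by Cor. 3.6 entry 1, summed with the overlap count N
  have hT : ∀ i, HasMajorant (g := toB6 g R H) 𝔬.blk (mulOp (𝔬.h i) * 𝔬.Gsq U i * mulOp (𝔬.h i))
      (fun (a b : g.Site) => (if a ∈ 𝔬.S i then (1 : ℝ) else 0) * (B₀ * g.len a ^ 2 * Real.exp (-(δ₀ * g.dist a b)))) :=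
    fun i => hasMajorant_mono (g := toB6 g R H) 𝔬.blk
      (hasMajorant_sandwich_local (R := R) (H := H) 𝔬.blk (hl.e0 i) (𝔬.h i) (hs.hh i) (𝔬.S i) (hs.hS i))
      fun a b => le_of_eq (by split_ifs <;> simp)
  have hG0 : HasMajorant (g := toB6 g R H) 𝔬.blk (∑ i, mulOp (𝔬.h i) * 𝔬.Gsq U i * mulOp (𝔬.h i))
      (fun (a b : g.Site) => N * B₀ * g.len a ^ 2 * Real.exp (-(δ₀ * g.dist a b))) := by
    have hloc := hasMajorant_localSum (G := toB6 g R H) 𝔬.blk (fun i => mulOp (𝔬.h i) * 𝔬.Gsq U i * mulOp (𝔬.h i))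
      (fun i (a : g.Site) => if a ∈ 𝔬.S i then (1 : ℝ) else 0)
      (fun (a b : g.Site) => B₀ * g.len a ^ 2 * Real.exp (-(δ₀ * g.dist a b))) N
      (fun a b => mul_nonneg (mul_nonneg hB₀ (sq_nonneg _)) (Real.exp_nonneg _)) hT hs.cnt
    exact hasMajorant_mono (g := toB6 g R H) 𝔬.blk hloc fun a b => le_of_eq (by ring)
  have e1 := majorant_of_fixedPoint_266 (g := toB6 g R H) 𝔬.blk d δ₀ α (NF * (θ₀ * g.M⁻¹)) (N * B₀)
    (fun a => g.len a ^ 2) (mul_nonneg hN hB₀) (fun a => sq_nonneg _) hθ h1αδ htri hs.refl hs.dnn h261 h263 hsmall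
    hG0 hR hfix
  -- entries 2 and 4: the left legs E(h_□G_□h_□) by the Leibniz rules, summed, then the two-space Neumann series
  have leftSum : ∀ {Z : Type} [Fintype Z] [DecidableEq Z] (blkZ : Z → g.Site) (E : (X → ℝ) →ₗ[ℝ] (Z → ℝ))
      (W : g.Site → ℝ) (s : ℝ), (∀ y, 0 ≤ W y) → 0 ≤ s →
      (∀ i, HasMajorantHom (g := toB6 g R H) 𝔬.blk blkZ (E ∘ₗ (mulOp (𝔬.h i) * 𝔬.Gsq U i * mulOp (𝔬.h i)))
        (fun (a b : g.Site) => ((if a ∈ 𝔬.S i then (1 : ℝ) else 0) * (B₀ * W a) +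
          (if a ∈ 𝔬.S' i then (1 : ℝ) else 0) * (B₀ * Real.exp (δ₀ * ρ) * s * W a)) * Real.exp (-(δ₀ * g.dist a b)))) →
      HasMajorantHom (g := toB6 g R H) 𝔬.blk blkZ (E ∘ₗ 𝔬.G U)
        (fun (a b : g.Site) => B₀ * (N + N' * Real.exp (δ₀ * ρ) * s) * B6.c1 d δ₀ α *
          (1 - NF * (θ₀ * g.M⁻¹) * B6.c1 d δ₀ α)⁻¹ * W a * Real.exp (-((1 - α) * δ₀ * g.dist a b))) := by
    intro Z _ _ blkZ E W s hW hs0 hcube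
    have hA : 0 ≤ B₀ * (N + N' * Real.exp (δ₀ * ρ) * s) := mul_nonneg hB₀ (add_nonneg hN (mul_nonneg hN'e hs0))
    have hsumE : E ∘ₗ (∑ i, mulOp (𝔬.h i) * 𝔬.Gsq U i * mulOp (𝔬.h i)) =
        ∑ i, E ∘ₗ (mulOp (𝔬.h i) * 𝔬.Gsq U i * mulOp (𝔬.h i)) := by
      apply LinearMap.ext
      intro μ
      rw [LinearMap.comp_apply, LinearMap.sum_apply, LinearMap.sum_apply, map_sum]
      rfl
    have hS₀ : HasMajorantHom (g := toB6 g R H) 𝔬.blk blkZ (E ∘ₗ ∑ i, mulOp (𝔬.h i) * 𝔬.Gsq U i * mulOp (𝔬.h i))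
        (fun (a b : g.Site) => B₀ * (N + N' * Real.exp (δ₀ * ρ) * s) * W a * Real.exp (-(δ₀ * g.dist a b))) := by
      rw [hsumE]
      refine hasMajorantHom_mono (g := toB6 g R H) 𝔬.blk blkZ
        (hasMajorantHom_fintypeSum 𝔬.blk blkZ (fun i => E ∘ₗ (mulOp (𝔬.h i) * 𝔬.Gsq U i * mulOp (𝔬.h i))) _ hcube)
        fun a b => ?_
      have h1 : 0 ≤ B₀ * W a := mul_nonneg hB₀ (hW a)
      have h2 : 0 ≤ B₀ * Real.exp (δ₀ * ρ) * s * W a :=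
        mul_nonneg (mul_nonneg (mul_nonneg hB₀ (Real.exp_nonneg _)) hs0) (hW a)
      calc (∑ i, ((if a ∈ 𝔬.S i then (1 : ℝ) else 0) * (B₀ * W a) +
              (if a ∈ 𝔬.S' i then (1 : ℝ) else 0) * (B₀ * Real.exp (δ₀ * ρ) * s * W a)) *
              Real.exp (-(δ₀ * g.dist a b)))
          = ((∑ i, if a ∈ 𝔬.S i then (1 : ℝ) else 0) * (B₀ * W a) +
              (∑ i, if a ∈ 𝔬.S' i then (1 : ℝ) else 0) * (B₀ * Real.exp (δ₀ * ρ) * s * W a)) *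
              Real.exp (-(δ₀ * g.dist a b)) := by
            simp only [Finset.sum_mul, add_mul, Finset.sum_add_distrib]
        _ ≤ (N * (B₀ * W a) + N' * (B₀ * Real.exp (δ₀ * ρ) * s * W a)) * Real.exp (-(δ₀ * g.dist a b)) :=
            mul_le_mul_of_nonneg_right (add_le_add (mul_le_mul_of_nonneg_right (hs.cnt a) h1)
              (mul_le_mul_of_nonneg_right (hs.cnt' a) h2)) (Real.exp_nonneg _)
        _ = B₀ * (N + N' * Real.exp (δ₀ * ρ) * s) * W a * Real.exp (-(δ₀ * g.dist a b)) := by ring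
    have hmain := hom_majorant_of_fixedPoint_266 (g := toB6 g R H) 𝔬.blk blkZ d δ₀ α (NF * (θ₀ * g.M⁻¹))
      (B₀ * (N + N' * Real.exp (δ₀ * ρ) * s)) W hA hW hθ h1αδ htri hs.refl hs.dnn h261 h263 hsmall hS₀ hR
      (leftEntry_fixpoint E hfix)
    exact hasMajorantHom_mono (g := toB6 g R H) 𝔬.blk blkZ hmain fun a b => le_of_eq (by simp only [toB6_dist])
  have e2 := leftSum 𝔬.blkY (𝔬.D U) (fun y => g.len y) (κ.kPD + κ.kCD) hlen hkD fun i =>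
    leftEntry_cube_majorant 𝔬.blk 𝔬.blkY 𝔬.blkY δ₀ ρ B₀ κ.kPD κ.kCD (fun y => g.len y) (𝔬.S i) (𝔬.S' i) (𝔬.h i)
      (𝔬.hY i) (𝔬.KPD i) (𝔬.KCD i) hB₀ hδ₀ htri hlen (hs.hh i) (hs.hhY i) (hs.hSY i) (hs.KPD_nonneg i) (hs.KPD_loc i)
      (hs.KPD_row i) (hs.KCD_nonneg i) (hs.KCD_loc i) (hs.KCD_row i) (hl.e0 i) (hl.e1 i) (hl.e1 i) (hi.hPD i) (hi.hCD i)
      (hi.leibD i)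
  have e4 := leftSum 𝔬.blk (𝔬.Lap U) (fun _ => (1 : ℝ)) (κ.kPL + κ.kCL) (fun _ => zero_le_one) hkL fun i =>
    leftEntry_cube_majorant 𝔬.blk 𝔬.blkY 𝔬.blk δ₀ ρ B₀ κ.kPL κ.kCL (fun _ => (1 : ℝ)) (𝔬.S i) (𝔬.S' i) (𝔬.h i)
      (𝔬.h i) (𝔬.KPL i) (𝔬.KCL i) hB₀ hδ₀ htri hlen (hs.hh i) (hs.hh i) (hs.hS i) (hs.KPL_nonneg i) (hs.KPL_loc i)
      (fun a => by simpa only [mul_one] using hs.KPL_row i a) (hs.KCL_nonneg i) (hs.KCL_loc i)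
      (fun a => by simpa only [mul_one] using hs.KCL_row i a) (hl.e0 i) (hl.e1 i)
      (hasMajorantHom_mono (g := toB6 g R H) 𝔬.blk 𝔬.blk (hl.e3 i) fun a b => by simp only [mul_one, le_refl])
      (hi.hPL i) (hi.hCL i) (hi.leibL i)
  -- entry 3: the right legs h_□G_□h_□∇*_U by the right Leibniz rule, the transposed factors, the weighted left fixed point
  have hcube3 : ∀ i, HasMajorantHom (g := toB6 g R H) 𝔬.blkY 𝔬.blk ((mulOp (𝔬.h i) * 𝔬.Gsq U i * mulOp (𝔬.h i)) ∘ₗ 𝔬.Dstar U)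
      (fun (a b : g.Site) => ((if a ∈ 𝔬.S i then (1 : ℝ) else 0) * (B₀ * g.len a) +
        (if b ∈ 𝔬.S' i then (1 : ℝ) else 0) * (B₀ * Real.exp (δ₀ * ρ) * Cℓ * κ.kCLt * g.len a)) *
        Real.exp (-(δ₀ * g.dist a b))) := fun i =>
    rightEntry_cube_majorant 𝔬.blk 𝔬.blkY δ₀ ρ B₀ κ.kCLt Cℓ (𝔬.S i) (𝔬.S' i) (𝔬.h i) (𝔬.hY i) (𝔬.KCLt i) hB₀ hδ₀
      hκ.nonneg.kCLt hCℓ0 htri hs.lenpos (hs.hh i) (hs.hS i) (hs.hhY i) (hs.comp i) (hs.KCLt_nonneg i) (hs.KCLt_loc i)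
      (hs.KCLt_col i) (hl.e0 i) (hl.e2 i) (hi.hCLt i) (hi.leibT i)
  have hsumD : (∑ i, mulOp (𝔬.h i) * 𝔬.Gsq U i * mulOp (𝔬.h i)) ∘ₗ 𝔬.Dstar U =
      ∑ i, (mulOp (𝔬.h i) * 𝔬.Gsq U i * mulOp (𝔬.h i)) ∘ₗ 𝔬.Dstar U := by
    apply LinearMap.ext
    intro μ
    simp only [LinearMap.comp_apply, LinearMap.sum_apply]
  have hT₀ : HasMajorantHom (g := toB6 g R H) 𝔬.blkY 𝔬.blk ((∑ i, mulOp (𝔬.h i) * 𝔬.Gsq U i * mulOp (𝔬.h i)) ∘ₗ 𝔬.Dstar U)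
      (fun (a b : g.Site) => B₀ * (N + N' * Real.exp (δ₀ * ρ) * Cℓ * κ.kCLt) * g.len a * 1 *
        Real.exp (-(δ₀ * g.dist a b))) := by
    rw [hsumD]
    refine hasMajorantHom_mono (g := toB6 g R H) 𝔬.blkY 𝔬.blk
      (hasMajorantHom_fintypeSum 𝔬.blkY 𝔬.blk (fun i => (mulOp (𝔬.h i) * 𝔬.Gsq U i * mulOp (𝔬.h i)) ∘ₗ 𝔬.Dstar U) _
        hcube3) fun (a b : g.Site) => ?_
    have h1 : 0 ≤ B₀ * g.len a := mul_nonneg hB₀ (hlen a)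
    have h2 : 0 ≤ B₀ * Real.exp (δ₀ * ρ) * Cℓ * κ.kCLt * g.len a :=
      mul_nonneg (mul_nonneg (mul_nonneg (mul_nonneg hB₀ (Real.exp_nonneg _)) hCℓ0) hκ.nonneg.kCLt) (hlen a)
    calc (∑ i, ((if a ∈ 𝔬.S i then (1 : ℝ) else 0) * (B₀ * g.len a) +
            (if b ∈ 𝔬.S' i then (1 : ℝ) else 0) * (B₀ * Real.exp (δ₀ * ρ) * Cℓ * κ.kCLt * g.len a)) *
            Real.exp (-(δ₀ * g.dist a b)))
        = ((∑ i, if a ∈ 𝔬.S i then (1 : ℝ) else 0) * (B₀ * g.len a) +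
            (∑ i, if b ∈ 𝔬.S' i then (1 : ℝ) else 0) * (B₀ * Real.exp (δ₀ * ρ) * Cℓ * κ.kCLt * g.len a)) *
            Real.exp (-(δ₀ * g.dist a b)) := by
          simp only [Finset.sum_mul, add_mul, Finset.sum_add_distrib]
      _ ≤ (N * (B₀ * g.len a) + N' * (B₀ * Real.exp (δ₀ * ρ) * Cℓ * κ.kCLt * g.len a)) *
            Real.exp (-(δ₀ * g.dist a b)) :=
          mul_le_mul_of_nonneg_right (add_le_add (mul_le_mul_of_nonneg_right (hs.cnt a) h1)
            (mul_le_mul_of_nonneg_right (hs.cnt' b) h2)) (Real.exp_nonneg _)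
      _ = B₀ * (N + N' * Real.exp (δ₀ * ρ) * Cℓ * κ.kCLt) * g.len a * 1 * Real.exp (-(δ₀ * g.dist a b)) := by ring
  -- R♯ = Σ_a R♯_a has the scale-weighted majorant N_F·θ₀M⁻¹·L^jη(L^{j′}η)⁻¹·e^{−δ₀d}
  have hV : HasMajorant (g := toB6 g R H) 𝔬.blk (∑ a, 𝔬.Rt U a)
      (fun (y y' : g.Site) => NF * (θ₀ * g.M⁻¹) * g.len y * (g.len y')⁻¹ * Real.exp (-(δ₀ * g.dist y y'))) := by
    rw [← hasMajorantHom_iff (g := toB6 g R H) 𝔬.blk]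
    refine hasMajorantHom_mono (g := toB6 g R H) 𝔬.blk 𝔬.blk
      (hasMajorantHom_fintypeSum 𝔬.blk 𝔬.blk (fun a => 𝔬.Rt U a) _ fun a =>
        (hasMajorantHom_iff (g := toB6 g R H) 𝔬.blk _ _).mpr (hf.facT a)) fun (y y' : g.Site) => ?_
    have h3 : 0 ≤ (θ₀ * g.M⁻¹) * (g.len y * (g.len y')⁻¹) * Real.exp (-(δ₀ * g.dist y y')) :=
      mul_nonneg (mul_nonneg hθM (mul_nonneg (hlen y) (inv_nonneg.mpr (hlen y')))) (Real.exp_nonneg _)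
    calc (∑ a, (if y' ∈ 𝔬.SF a then (1 : ℝ) else 0) * (θ₀ * g.M⁻¹) * (g.len y * (g.len y')⁻¹) *
            Real.exp (-(δ₀ * g.dist y y')))
        = (∑ a, if y' ∈ 𝔬.SF a then (1 : ℝ) else 0) *
            ((θ₀ * g.M⁻¹) * (g.len y * (g.len y')⁻¹) * Real.exp (-(δ₀ * g.dist y y'))) := by
          rw [Finset.sum_mul]
          exact Finset.sum_congr rfl fun a _ => by ring
      _ ≤ NF * ((θ₀ * g.M⁻¹) * (g.len y * (g.len y')⁻¹) * Real.exp (-(δ₀ * g.dist y y'))) :=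
          mul_le_mul_of_nonneg_right (hs.cntF y') h3
      _ = NF * (θ₀ * g.M⁻¹) * g.len y * (g.len y')⁻¹ * Real.exp (-(δ₀ * g.dist y y')) := by ring
  have hGT : 𝔬.G U = (∑ i, mulOp (𝔬.h i) * 𝔬.Gsq U i * mulOp (𝔬.h i)) + (∑ a, 𝔬.Rt U a) * 𝔬.G U :=
    fixedPoint_of_388T hi.invT hi.eq3105T
  have hfixT : 𝔬.G U ∘ₗ 𝔬.Dstar U = (∑ i, mulOp (𝔬.h i) * 𝔬.Gsq U i * mulOp (𝔬.h i)) ∘ₗ 𝔬.Dstar U +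
      (∑ a, 𝔬.Rt U a) ∘ₗ (𝔬.G U ∘ₗ 𝔬.Dstar U) := by
    conv_lhs => rw [hGT]
    rw [LinearMap.add_comp, Module.End.mul_eq_comp, LinearMap.comp_assoc]
  have htransfer : ∀ a b : g.Site, (1 : ℝ) ≤ 1 * 1 * Real.exp (α * δ₀ * g.dist a b) := fun a b => by
    rw [one_mul, one_mul]
    exact Real.one_le_exp (mul_nonneg hαδ (hs.dnn a b))
  have hA3 : 0 ≤ B₀ * (N + N' * Real.exp (δ₀ * ρ) * Cℓ * κ.kCLt) :=
    mul_nonneg hB₀ (add_nonneg hN (mul_nonneg (mul_nonneg hN'e hCℓ0) hκ.nonneg.kCLt))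
  have e3 := hom_majorant_of_leftFixedPoint_weighted (g := toB6 g R H) 𝔬.blk 𝔬.blkY d δ₀ α (NF * (θ₀ * g.M⁻¹))
    (B₀ * (N + N' * Real.exp (δ₀ * ρ) * Cℓ * κ.kCLt)) 1 (fun y => g.len y) (fun _ => (1 : ℝ)) hA3 zero_le_one hs.lenpos
    (fun _ => zero_le_one) hθ hαδ hαδ2 htri hs.refl hs.symm hs.dnn h261 h263 hsmall htransfer hT₀ hV hfixT
  -- the comparisons of the four constants with A′ = B₀(N + N′e^{δ₀ρ}(C_ℓK))c₁
  have hA1 : 0 ≤ N * B₀ * B6.c1 d δ₀ α := mul_nonneg (mul_nonneg hN hB₀) hc1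
  have hA1' : N * B₀ * B6.c1 d δ₀ α ≤ B₀ * (N + N' * Real.exp (δ₀ * ρ) * (Cℓ * K)) * B6.c1 d δ₀ α := by
    have h1 : N ≤ N + N' * Real.exp (δ₀ * ρ) * (Cℓ * K) :=
      le_add_of_nonneg_right (mul_nonneg hN'e (mul_nonneg hCℓ0 hK))
    calc N * B₀ * B6.c1 d δ₀ α = N * (B₀ * B6.c1 d δ₀ α) := by ring
      _ ≤ (N + N' * Real.exp (δ₀ * ρ) * (Cℓ * K)) * (B₀ * B6.c1 d δ₀ α) :=
          mul_le_mul_of_nonneg_right h1 (mul_nonneg hB₀ hc1)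
      _ = B₀ * (N + N' * Real.exp (δ₀ * ρ) * (Cℓ * K)) * B6.c1 d δ₀ α := by ring
  have hA2 : 0 ≤ B₀ * (N + N' * Real.exp (δ₀ * ρ) * (κ.kPD + κ.kCD)) * B6.c1 d δ₀ α :=
    mul_nonneg (mul_nonneg hB₀ (add_nonneg hN (mul_nonneg hN'e hkD))) hc1
  have hA2' : B₀ * (N + N' * Real.exp (δ₀ * ρ) * (κ.kPD + κ.kCD)) * B6.c1 d δ₀ α ≤
      B₀ * (N + N' * Real.exp (δ₀ * ρ) * (Cℓ * K)) * B6.c1 d δ₀ α :=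
    constA_le hB₀ hN'e hc1 (hκ.leibD.trans hKCℓ)
  have hA4 : 0 ≤ B₀ * (N + N' * Real.exp (δ₀ * ρ) * (κ.kPL + κ.kCL)) * B6.c1 d δ₀ α :=
    mul_nonneg (mul_nonneg hB₀ (add_nonneg hN (mul_nonneg hN'e hkL))) hc1
  have hA4' : B₀ * (N + N' * Real.exp (δ₀ * ρ) * (κ.kPL + κ.kCL)) * B6.c1 d δ₀ α ≤
      B₀ * (N + N' * Real.exp (δ₀ * ρ) * (Cℓ * K)) * B6.c1 d δ₀ α :=
    constA_le hB₀ hN'e hc1 (hκ.leibL.trans hKCℓ)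
  have hA3c : 0 ≤ B₀ * (N + N' * Real.exp (δ₀ * ρ) * Cℓ * κ.kCLt) * B6.c1 d δ₀ α := mul_nonneg hA3 hc1
  have hA3' : B₀ * (N + N' * Real.exp (δ₀ * ρ) * Cℓ * κ.kCLt) * B6.c1 d δ₀ α ≤
      B₀ * (N + N' * Real.exp (δ₀ * ρ) * (Cℓ * K)) * B6.c1 d δ₀ α := by
    have h := constA_le (N := N) hB₀ hN'e hc1 (mul_le_mul_of_nonneg_left hκ.leibT hCℓ0)
    calc B₀ * (N + N' * Real.exp (δ₀ * ρ) * Cℓ * κ.kCLt) * B6.c1 d δ₀ α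
        = B₀ * (N + N' * Real.exp (δ₀ * ρ) * (Cℓ * κ.kCLt)) * B6.c1 d δ₀ α := by ring
      _ ≤ B₀ * (N + N' * Real.exp (δ₀ * ρ) * (Cℓ * K)) * B6.c1 d δ₀ α := h
  refine ⟨?_, ?_, ?_, ?_⟩
  · refine hasMajorant_mono (g := toB6 g R H) 𝔬.blk e1 fun a b => ?_
    calc N * B₀ * B6.c1 d δ₀ α * (1 - NF * (θ₀ * g.M⁻¹) * B6.c1 d δ₀ α)⁻¹ * g.len a ^ 2 *
          Real.exp (-((1 - α) * δ₀ * g.dist a b))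
        ≤ 2 * (B₀ * (N + N' * Real.exp (δ₀ * ρ) * (Cℓ * K)) * B6.c1 d δ₀ α) * g.len a ^ 2 *
            Real.exp (-((1 - 2 * α) * δ₀ * g.dist a b)) :=
          weaken hA1 hA1' hq (sq_nonneg _) (Real.exp_nonneg _) (hexp a b)
      _ = _ := hfin _ _
  · refine hasMajorantHom_mono (g := toB6 g R H) 𝔬.blk 𝔬.blkY e2 fun a b => ?_
    calc B₀ * (N + N' * Real.exp (δ₀ * ρ) * (κ.kPD + κ.kCD)) * B6.c1 d δ₀ α *
          (1 - NF * (θ₀ * g.M⁻¹) * B6.c1 d δ₀ α)⁻¹ * g.len a * Real.exp (-((1 - α) * δ₀ * g.dist a b))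
        ≤ 2 * (B₀ * (N + N' * Real.exp (δ₀ * ρ) * (Cℓ * K)) * B6.c1 d δ₀ α) * g.len a *
            Real.exp (-((1 - 2 * α) * δ₀ * g.dist a b)) :=
          weaken hA2 hA2' hq (hlen a) (Real.exp_nonneg _) (hexp a b)
      _ = _ := hfin _ _
  · refine hasMajorantHom_mono (g := toB6 g R H) 𝔬.blkY 𝔬.blk e3 fun a b => ?_
    calc B₀ * (N + N' * Real.exp (δ₀ * ρ) * Cℓ * κ.kCLt) * 1 * B6.c1 d δ₀ α *
          (1 - NF * (θ₀ * g.M⁻¹) * B6.c1 d δ₀ α)⁻¹ * g.len a * (fun _ => (1 : ℝ)) b *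
          Real.exp (-((1 - 2 * α) * δ₀ * g.dist a b))
        = B₀ * (N + N' * Real.exp (δ₀ * ρ) * Cℓ * κ.kCLt) * B6.c1 d δ₀ α *
            (1 - NF * (θ₀ * g.M⁻¹) * B6.c1 d δ₀ α)⁻¹ * g.len a * Real.exp (-((1 - 2 * α) * δ₀ * g.dist a b)) := by
          ring
      _ ≤ 2 * (B₀ * (N + N' * Real.exp (δ₀ * ρ) * (Cℓ * K)) * B6.c1 d δ₀ α) * g.len a *
            Real.exp (-((1 - 2 * α) * δ₀ * g.dist a b)) :=
          weaken hA3c hA3' hq (hlen a) (Real.exp_nonneg _) le_rfl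
      _ = _ := hfin _ _
  · refine hasMajorantHom_mono (g := toB6 g R H) 𝔬.blk 𝔬.blk e4 fun a b => ?_
    calc B₀ * (N + N' * Real.exp (δ₀ * ρ) * (κ.kPL + κ.kCL)) * B6.c1 d δ₀ α *
          (1 - NF * (θ₀ * g.M⁻¹) * B6.c1 d δ₀ α)⁻¹ * (fun _ => (1 : ℝ)) a *
          Real.exp (-((1 - α) * δ₀ * g.dist a b))
        ≤ 2 * (B₀ * (N + N' * Real.exp (δ₀ * ρ) * (Cℓ * K)) * B6.c1 d δ₀ α) * (fun _ => (1 : ℝ)) a *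
            Real.exp (-((1 - 2 * α) * δ₀ * g.dist a b)) :=
          weaken hA4 hA4' hq zero_le_one (Real.exp_nonneg _) (hexp a b)
      _ = const37 d δ₀ α ρ B₀ N N' Cℓ K * Real.exp (-((1 - 2 * α) * δ₀ * g.dist a b)) := by
          simp only [const37]
          ring

omit [Fintype g.Site] [DecidableEq g.Site] in
/-- **The U-localisation clause of Theorem 3.10** (*"A term in this expansion, corresponding to a walk ω, depends on
configuration U restricted to X̃⁵₀ ∪ X̃⁵₁ ∪ … ∪ X̃⁵ₙ"*, p. 416) at `W310OfOps`, from the two printed locality inputs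
(`Locality310`): the head factor depends on U|□̃⁵₀ and each R_{αᵢ}(Xᵢ) on U|X̃⁵ᵢ (p. 413).
[cite: Balaban1985BackgroundPropagators, Thm 3.10 p.416 + p.413] -/
theorem locDep_W310OfOps (𝔬 : Ops310 g B X Y ι A) (rd : WalkReading310 g B X ι A) (Conv : B.Cfg → Prop)
    (hloc : Locality310 𝔬 rd) (U : B.Cfg) (w : ℕ × ι × (ℕ → A)) : (W310OfOps 𝔬 rd Conv).LocDep U w := by
  intro U' hU₀ hU'
  refine lprod_congr w.1 fun k hk => ?_
  by_cases hk0 : k = 0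
  · subst hk0
    simp only [walkOps310, if_true]
    exact hloc.gsq w.2.1 U U' hU₀
  · simp only [walkOps310, hk0, if_false]
    exact hloc.fac (w.2.2 k) U U' (hU' k (by omega) hk)

/-- **THE BOUND (3.108) at one member and one configuration U** (p. 416: *"|(R₀(X₀)R_{α₁}(X₁)·⋯·R_{αₙ}(Xₙ)J)(x)| ≦ O(1)(L^jη)²
O(M^{−1/2})^{|ω|}M^{−1/2|ω|}e^{−(1/2)δ₀d(ω,y,y′)}|J|, x ∈ Δ(y), y ∈ Λ_j, supp J ⊂ Δ(y′)"*) at the datum `W310OfOps`, with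
O(1) = B₀, O(M^{−1/2}) = (θ₀c₁(α) + 1)M^{−1/2} and ½δ₀′, δ₀′ = 2(1 − α)δ₀: from Corollary 3.6 entry 1 for G_{□₀}(U)
(`Local342G`), the (3.89)-type bounds of the factors (`Factors389`), the static data, [4] (2.61) at α and the reading clauses —
by `B9Thm37Sum.cor38_walk_majorant` ((3.91)–(3.92): the product has majorant 1_{S_{□₀}}(y)B₀(L^jη)²(θ₀M⁻¹c₁(α))ⁿ
e^{−(1−α)δ₀d_ω}), `B9Cor38Whole.LB_minLen` ((3.93)) and `B9.split_small_factor` (the printed split (cM⁻¹)ⁿ = (cM^{−1/2})ⁿM^{−n/2}).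
[cite: Balaban1985BackgroundPropagators, Thm 3.10 (3.108) p.416 + Cor. 3.8 (3.91)–(3.94) p.410 + p.413; Balaban1984PropagatorsII, Lemma 2.1 (2.61) p.234] -/
theorem term_W310OfOps_le [Fintype ι] [Fintype A] (𝔬 : Ops310 g B X Y ι A) (rd : WalkReading310 g B X ι A)
    (Conv : B.Cfg → Prop) (R : ℝ) (H : Prop) (d : ℕ) (δ₀ α ρ B₀ N N' NF Cℓ θ₀ : ℝ) (κ : Sizes310) (U : B.Cfg)
    (hB₀ : 0 ≤ B₀) (hδ₀ : 0 ≤ δ₀) (hα : 0 ≤ α) (hα1 : α ≤ 1) (hθ₀ : 0 ≤ θ₀) (hM : 0 < g.M)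
    (hs : StaticOK310 𝔬 ρ N N' NF Cℓ κ) (h261 : Ineq261 d (toB6 g R H) δ₀ α) (hrd : rd.OK 𝔬.blk)
    (hl : Local342G 𝔬 R H B₀ δ₀ U) (hf : Factors389 𝔬 R H θ₀ δ₀ U) (w : ℕ × ι × (ℕ → A)) (lam : g.Loc) (y y' : g.Site)
    (hy : y ∈ 𝔬.S w.2.1) (hlam : g.suppIn lam y') :
    (W310OfOps 𝔬 rd Conv).term U w lam y ≤
      g.len y ^ 2 * B9.walkFactor B₀ (θ₀ * B6.c1 d δ₀ α + 1) g.M (2 * ((1 - α) * δ₀))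
        ((W310OfOps 𝔬 rd Conv).wlen w) ((W310OfOps 𝔬 rd Conv).wdist w y y') * g.supNorm lam := by
  obtain ⟨n, q, a⟩ := w
  have hαδ : 0 ≤ α * δ₀ := mul_nonneg hα hδ₀
  have h1αδ : 0 ≤ (1 - α) * δ₀ := mul_nonneg (by linarith) hδ₀
  have hc1 : 0 ≤ B6.c1 d δ₀ α := c1_nonneg d δ₀ α
  have hθM : 0 ≤ θ₀ * g.M⁻¹ := mul_nonneg hθ₀ (inv_nonneg.mpr hM.le)
  have hcpos : 0 < θ₀ * B6.c1 d δ₀ α + 1 := by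
    have h0 : 0 ≤ θ₀ * B6.c1 d δ₀ α := mul_nonneg hθ₀ hc1
    linarith
  -- (3.91)–(3.92): the term has the majorant 1_{S_{□₀}}(y)B₀(L^jη)²(θ₀M⁻¹c₁)ⁿe^{−(1−α)δ₀dω}
  have hmaj := cor38_walk_majorant (R := R) (H := H) 𝔬.blk d δ₀ α (θ₀ * g.M⁻¹) B₀ (walkSets310 𝔬 q a)
    (walkOps310 𝔬 U q a) (minLen g.dist (walkSets310 𝔬 q a) n) n hB₀ hθM hs.dnn hαδ h1αδ h261
    (by
      simp only [walkOps310, walkSets310, if_true]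
      exact hasMajorant_sandwich_local (R := R) (H := H) 𝔬.blk (hl.e0 q) (𝔬.h q) (hs.hh q) (𝔬.S q) (hs.hS q))
    (fun k hk _ => by
      have hk0 : k ≠ 0 := by omega
      simp only [walkOps310, walkSets310, hk0, if_false]
      exact hf.fac (a k))
    (fun a' b' => LB_minLen g.dist n (walkSets310 𝔬 q a) a' b')
  -- evaluate at the argument J: supp J ⊂ Δ(y′), |ev J| ≦ |J|
  have hμ : BlockSupp (g := toB6 g R H) 𝔬.blk (rd.ev lam) y' (g.supNorm lam) :=
    ⟨hrd.norm_nonneg lam, fun x _ => hrd.bound lam x, hrd.off lam y' hlam⟩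
  have hpt : ∀ x, 𝔬.blk x = y → |lprod (walkOps310 𝔬 U q a) n (rd.ev lam) x| ≤
      B₀ * g.len y ^ 2 * (θ₀ * g.M⁻¹ * B6.c1 d δ₀ α) ^ n *
        Real.exp (-((1 - α) * δ₀ * (minLen g.dist (walkSets310 𝔬 q a) n y y'))) * g.supNorm lam := by
    intro x hx
    have hb := hmaj y' (rd.ev lam) (g.supNorm lam) hμ x
    rw [hx] at hb
    refine hb.trans (le_of_eq ?_)
    simp only [walkSets310, if_true, if_pos hy]
  -- (θ₀M⁻¹c₁)ⁿ ≦ (cM⁻¹)ⁿ = (cM^{−1/2})ⁿM^{−n/2}, c = θ₀c₁ + 1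
  have hθc : θ₀ * g.M⁻¹ * B6.c1 d δ₀ α ≤ (θ₀ * B6.c1 d δ₀ α + 1) * g.M⁻¹ := by
    have hMinv : 0 ≤ g.M⁻¹ := inv_nonneg.mpr hM.le
    calc θ₀ * g.M⁻¹ * B6.c1 d δ₀ α = (θ₀ * B6.c1 d δ₀ α) * g.M⁻¹ := by ring
      _ ≤ (θ₀ * B6.c1 d δ₀ α + 1) * g.M⁻¹ := mul_le_mul_of_nonneg_right (by linarith) hMinv
  have hpow : (θ₀ * g.M⁻¹ * B6.c1 d δ₀ α) ^ n ≤ ((θ₀ * B6.c1 d δ₀ α + 1) * g.M⁻¹) ^ n :=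
    pow_le_pow_left₀ (mul_nonneg hθM hc1) hθc n
  have hexp : Real.exp (-((1 - α) * δ₀ * (minLen g.dist (walkSets310 𝔬 q a) n y y'))) =
      Real.exp (-(2 * ((1 - α) * δ₀) / 2 * (minLen g.dist (walkSets310 𝔬 q a) n y y'))) := by
    congr 1; ring
  have hfac : B₀ * g.len y ^ 2 * (θ₀ * g.M⁻¹ * B6.c1 d δ₀ α) ^ n *
        Real.exp (-((1 - α) * δ₀ * (minLen g.dist (walkSets310 𝔬 q a) n y y'))) ≤
      g.len y ^ 2 * B9.walkFactor B₀ (θ₀ * B6.c1 d δ₀ α + 1) g.M (2 * ((1 - α) * δ₀)) n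
        (minLen g.dist (walkSets310 𝔬 q a) n y y') := by
    calc B₀ * g.len y ^ 2 * (θ₀ * g.M⁻¹ * B6.c1 d δ₀ α) ^ n *
          Real.exp (-((1 - α) * δ₀ * (minLen g.dist (walkSets310 𝔬 q a) n y y')))
        ≤ B₀ * g.len y ^ 2 * ((θ₀ * B6.c1 d δ₀ α + 1) * g.M⁻¹) ^ n *
            Real.exp (-((1 - α) * δ₀ * (minLen g.dist (walkSets310 𝔬 q a) n y y'))) :=
          mul_le_mul_of_nonneg_right (mul_le_mul_of_nonneg_left hpow (mul_nonneg hB₀ (sq_nonneg _)))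
            (Real.exp_nonneg _)
      _ = g.len y ^ 2 * B9.walkFactor B₀ (θ₀ * B6.c1 d δ₀ α + 1) g.M (2 * ((1 - α) * δ₀)) n
            (minLen g.dist (walkSets310 𝔬 q a) n y y') := by
          rw [B9.split_small_factor (θ₀ * B6.c1 d δ₀ α + 1) g.M hM n, hexp]
          simp only [B9.walkFactor]
          ring
  have hrhs : 0 ≤ g.len y ^ 2 * B9.walkFactor B₀ (θ₀ * B6.c1 d δ₀ α + 1) g.M (2 * ((1 - α) * δ₀)) n
      (minLen g.dist (walkSets310 𝔬 q a) n y y') * g.supNorm lam := by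
    refine mul_nonneg (mul_nonneg (sq_nonneg _) ?_) (hrd.norm_nonneg lam)
    simp only [B9.walkFactor]
    exact mul_nonneg (mul_nonneg (mul_nonneg hB₀ (pow_nonneg (mul_nonneg hcpos.le
      (Real.rpow_nonneg hM.le _)) _)) (Real.rpow_nonneg hM.le _)) (Real.exp_nonneg _)
  show blkSup 𝔬.blk (fun x => |lprod (walkOps310 𝔬 U q a) n (rd.ev lam) x|) y ≤
    g.len y ^ 2 * B9.walkFactor B₀ (θ₀ * B6.c1 d δ₀ α + 1) g.M (2 * ((1 - α) * δ₀)) n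
      (minLen g.dist (walkSets310 𝔬 q a) n y y') * g.supNorm lam
  refine blkSup_le' 𝔬.blk hrhs fun x hx => (hpt x hx).trans ?_
  exact mul_le_mul_of_nonneg_right hfac (hrd.norm_nonneg lam)

omit [Fintype g.Site] [DecidableEq g.Site] in
/-- Arithmetic of «for M sufficiently large»: M ≧ 2N_Fθ₀c₁ gives N_F·θ₀M⁻¹·c₁ ≦ ½. [folklore] -/
private theorem small_of_threshold {NF θ₀ c M : ℝ} (hM : 0 < M) (hbig : 2 * NF * θ₀ * c ≤ M) :
    NF * (θ₀ * M⁻¹) * c ≤ 1 / 2 := by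
  have h1 : NF * (θ₀ * M⁻¹) * c = (NF * θ₀ * c) / M := by
    rw [div_eq_mul_inv]
    ring
  rw [h1, div_le_iff₀ hM]
  linarith

end OneMember

/-! ## §4 The whole printed leaf at the pinned datum -/

section Family

variable {I : Type} {c35 : ℝ} {geo : I → B9.Geometry} {bg : I → B9.Backgrounds}
variable [∀ i, Fintype (geo i).Site] [∀ i, DecidableEq (geo i).Site]
variable {X Y ι A : I → Type} [∀ i, Fintype (X i)] [∀ i, DecidableEq (X i)] [∀ i, Fintype (Y i)]
  [∀ i, DecidableEq (Y i)] [∀ i, Fintype (ι i)] [∀ i, Fintype (A i)]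

omit [∀ i, Fintype (X i)] [∀ i, DecidableEq (X i)] [∀ i, Fintype (Y i)] [∀ i, DecidableEq (Y i)] in
/-- **The leaf at `W310OfOps … Conv` from its two parts, for ANY pinned convergence predicate**: if `Conv i U` holds under
the printed provisos (M ≧ M_c, 0 < α₀, O(1)Mα₀ ≦ a₁, (3.35)) — the convergence content, supplied at the sup-block pin by
`conv3107_of_local3107` and at an all-blocks pin by the sibling `B9RWSums343to347Whole` — and the head legs G_□(U) (Cor. 3.6
entry 1, `Local342G`) and the factors (`Factors389`) obey their bounds under Cor. 3.6's provisos, then with the static data,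
the readings, the locality inputs and [4] (2.61) for M ≧ M_L the whole leaf `B9.Thm310Printed c35 geo bg (fun i => W310OfOps
(𝔬 i) (rd i) (Conv i))` holds: M₂ := max(M₁, M_L, M_c), a₀ := a₁∕O(1), δ₀′ := 2(1 − α)δ₀, O(1) := B₀, c := θ₀c₁(α) + 1 (the
bound (3.108) by `term_W310OfOps_le`, the localisation by `locDep_W310OfOps`).  Bookkeeping on the typed sentence; nothing of
print asserted. [cite: Balaban1985BackgroundPropagators, Thm 3.10 (3.107)–(3.108) pp.415–416 + Cor. 3.6 p.408] -/
theorem thm310Printed_of_parts (𝔬 : ∀ i, Ops310 (geo i) (bg i) (X i) (Y i) (ι i) (A i))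
    (rd : ∀ i, WalkReading310 (geo i) (bg i) (X i) (ι i) (A i)) (Conv : ∀ i, (bg i).Cfg → Prop) (R : I → ℝ)
    (H : I → Prop) (κ : I → Sizes310) (d : ℕ) (α ρ N N' NF Cℓ θ₀ B₀ δ₀ a₁ M₁ ML Mc : ℝ)
    (hc : 0 < c35) (hα : 0 ≤ α) (hα1 : α < 1) (hθ₀ : 0 ≤ θ₀) (hB₀ : 0 < B₀) (hδ₀ : 0 < δ₀) (ha₁ : 0 < a₁)
    (hM₁ : 0 < M₁) (hst : ∀ i, StaticOK310 (𝔬 i) ρ N N' NF Cℓ (κ i))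
    (hrd : ∀ i, (rd i).OK (𝔬 i).blk) (hloc : ∀ i, Locality310 (𝔬 i) (rd i))
    (h261 : ∀ i, ML ≤ (geo i).M → Ineq261 d (toB6 (geo i) (R i) (H i)) δ₀ α)
    (hconv : ∀ i, Mc ≤ (geo i).M → ∀ α₀ : ℝ, 0 < α₀ → c35 * (geo i).M * α₀ ≤ a₁ →
      ∀ U : (bg i).Cfg, (bg i).Reg335 c35 α₀ U → Conv i U)
    (h36 : ∀ i, M₁ ≤ (geo i).M → ∀ α₀ : ℝ, 0 < α₀ → c35 * (geo i).M * α₀ ≤ a₁ →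
      ∀ U : (bg i).Cfg, (bg i).Reg335 c35 α₀ U →
        Local342G (𝔬 i) (R i) (H i) B₀ δ₀ U ∧ Factors389 (𝔬 i) (R i) (H i) θ₀ δ₀ U) :
    B9.Thm310Printed c35 geo bg (fun i => W310OfOps (𝔬 i) (rd i) (Conv i)) := by
  have hc1 : 0 ≤ B6.c1 d δ₀ α := c1_nonneg d δ₀ α
  have hcpos : 0 < θ₀ * B6.c1 d δ₀ α + 1 := by
    have h0 : 0 ≤ θ₀ * B6.c1 d δ₀ α := mul_nonneg hθ₀ hc1
    linarith
  refine ⟨max M₁ (max ML Mc), a₁ / c35, 2 * ((1 - α) * δ₀), B₀, θ₀ * B6.c1 d δ₀ α + 1,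
    lt_max_of_lt_left hM₁, div_pos ha₁ hc, by nlinarith, hB₀, hcpos, ?_⟩
  intro i hM α₀ hα₀ hMa U hU
  have hM₁i : M₁ ≤ (geo i).M := le_trans (le_max_left _ _) hM
  have hMLi : ML ≤ (geo i).M := le_trans (le_trans (le_max_left _ _) (le_max_right _ _)) hM
  have hMci : Mc ≤ (geo i).M := le_trans (le_trans (le_max_right _ _) (le_max_right _ _)) hM
  have hMpos : 0 < (geo i).M := lt_of_lt_of_le hM₁ hM₁i
  have ha : c35 * (geo i).M * α₀ ≤ a₁ := by
    have h1 : (geo i).M * α₀ * c35 ≤ a₁ := (le_div_iff₀ hc).mp hMa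
    calc c35 * (geo i).M * α₀ = (geo i).M * α₀ * c35 := by ring
      _ ≤ a₁ := h1
  obtain ⟨hl, hf⟩ := h36 i hM₁i α₀ hα₀ ha U hU
  refine ⟨hconv i hMci α₀ hα₀ ha U hU, fun w lam y y' hfirst _hlast hlam => ⟨?_, ?_⟩⟩
  · exact locDep_W310OfOps (𝔬 i) (rd i) (Conv i) (hloc i) U w
  · exact term_W310OfOps_le (𝔬 i) (rd i) (Conv i) (R i) (H i) d δ₀ α ρ B₀ N N' NF Cℓ θ₀ (κ i) U hB₀.le hδ₀.le hα
      hα1.le hθ₀ hMpos (hst i) (h261 i hMLi) (hrd i) hl hf w lam y y' hfirst hlam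

/-- ★ **THEOREM 3.10 AS THE WHOLE PRINTED LEAF `B9.Thm310Printed`** (pp. 415–416: *"For M sufficiently large, and a
configuration U satisfying (3.35), the operator G has the expansion G = Σ_ω R₀(X₀)R_{α₁}(X₁)·⋯·R_{αₙ}(Xₙ), (3.107) … A term in
this expansion, corresponding to a walk ω, depends on configuration U restricted to X̃⁵₀ ∪ X̃⁵₁ ∪ … ∪ X̃⁵ₙ, satisfies the
inequality (3.108) … From (3.108) it follows that the expansion (3.107) is convergent in all norms in the inequalities
(3.42)–(3.47)."*), INHABITED at the sup-block pin `W310OfOps (𝔬 i) (rd i) (Conv3107 (𝔬 i) (R i) (H i) C δ)` with the explicit constants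
C = `const37 d δ₀ α ρ B₀ N N' Cℓ K`, δ = (1 − 2α)δ₀ (convergence), δ₀′ = 2(1 − α)δ₀, O(1) = B₀, c = θ₀c₁(α) + 1 (the bound
(3.108)) — from, per member and per U under the printed provisos of Corollary 3.6 (M ≧ M₁, 0 < α₀, O(1)Mα₀ ≦ a₁, U satisfying
(3.35) = `Reg335 c35 α₀ U`): «Cor. 3.6 for all G_□(U)» (`Local342G`), the (3.89)-type factor bounds (`Factors389`) and the
structure of the expansion (`Identities310`); per member: the static data (`StaticOK310`), the Leibniz sizes (`Sizes310.Bounded`),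
the readings (`WalkReading310.OK`), the locality inputs (`Locality310`), and [4] Lemma 2.1 (2.61) at the exponent α for
M ≧ M_L.  The printed quantifiers are met with M₂ := max(M₁, M_L, 2N_Fθ₀c₁(α)) and a₀ := a₁ ∕ O(1) (O(1) = `c35`, the
geometric factor of (3.35)).  Nothing of print asserted (all inputs are hypotheses of printed shape); the sup block (3.42) of
«all norms» only; NOT a node discharge.
[cite: Balaban1985BackgroundPropagators, Thm 3.10 (3.105)–(3.108) pp.414–416 + Cor. 3.6 p.408 + (3.35) p.396; Balaban1984PropagatorsII, Lemma 2.1 (2.61) p.234 + Prop 2.2 p.234] -/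
theorem thm310Printed_of_local3107 (𝔬 : ∀ i, Ops310 (geo i) (bg i) (X i) (Y i) (ι i) (A i))
    (rd : ∀ i, WalkReading310 (geo i) (bg i) (X i) (ι i) (A i)) (R : I → ℝ) (H : I → Prop) (κ : I → Sizes310)
    (d : ℕ) (α ρ N N' NF Cℓ K θ₀ B₀ δ₀ a₁ M₁ ML : ℝ)
    (hc : 0 < c35) (hα : 0 ≤ α) (hα2 : α ≤ 1 / 2) (hN : 0 ≤ N) (hN' : 0 ≤ N') (hNF : 0 ≤ NF) (hCℓ : 1 ≤ Cℓ)
    (hK : 0 ≤ K) (hθ₀ : 0 ≤ θ₀) (hB₀ : 0 < B₀) (hδ₀ : 0 < δ₀) (ha₁ : 0 < a₁) (hM₁ : 0 < M₁)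
    (hst : ∀ i, StaticOK310 (𝔬 i) ρ N N' NF Cℓ (κ i)) (hκ : ∀ i, (κ i).Bounded K)
    (hrd : ∀ i, (rd i).OK (𝔬 i).blk) (hloc : ∀ i, Locality310 (𝔬 i) (rd i))
    (h261 : ∀ i, ML ≤ (geo i).M → Ineq261 d (toB6 (geo i) (R i) (H i)) δ₀ α)
    (h36 : ∀ i, M₁ ≤ (geo i).M → ∀ α₀ : ℝ, 0 < α₀ → c35 * (geo i).M * α₀ ≤ a₁ →
      ∀ U : (bg i).Cfg, (bg i).Reg335 c35 α₀ U →
        Local342G (𝔬 i) (R i) (H i) B₀ δ₀ U ∧ Factors389 (𝔬 i) (R i) (H i) θ₀ δ₀ U ∧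
          Identities310 (𝔬 i) (R i) (H i) U) :
    B9.Thm310Printed c35 geo bg
      (fun i => W310OfOps (𝔬 i) (rd i)
        (Conv3107 (𝔬 i) (R i) (H i) (const37 d δ₀ α ρ B₀ N N' Cℓ K) ((1 - 2 * α) * δ₀))) := by
  refine thm310Printed_of_parts 𝔬 rd _ R H κ d α ρ N N' NF Cℓ θ₀ B₀ δ₀ a₁ M₁ ML
    (max M₁ (max ML (2 * NF * θ₀ * B6.c1 d δ₀ α))) hc hα (by linarith) hθ₀ hB₀ hδ₀ ha₁ hM₁ hst hrd hloc h261
    (fun i hM α₀ hα₀ ha U hU => ?_) (fun i hM α₀ hα₀ ha U hU => ?_)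
  · have hM₁i : M₁ ≤ (geo i).M := le_trans (le_max_left _ _) hM
    have hMLi : ML ≤ (geo i).M := le_trans (le_trans (le_max_left _ _) (le_max_right _ _)) hM
    have hbig : 2 * NF * θ₀ * B6.c1 d δ₀ α ≤ (geo i).M := le_trans (le_trans (le_max_right _ _) (le_max_right _ _)) hM
    have hMpos : 0 < (geo i).M := lt_of_lt_of_le hM₁ hM₁i
    obtain ⟨hl, hf, hi⟩ := h36 i hM₁i α₀ hα₀ ha U hU
    have hq : NF * (θ₀ * (geo i).M⁻¹) * B6.c1 d δ₀ α ≤ 1 / 2 := small_of_threshold hMpos hbig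
    exact conv3107_of_local3107 (𝔬 i) (R i) (H i) d δ₀ α ρ B₀ N N' NF Cℓ K θ₀ (κ i) U hB₀.le hδ₀.le hα hα2 hN hN'
      hNF hCℓ hK hθ₀ hMpos (hst i) (hκ i) (h261 i hMLi) hq hl hf hi
  · obtain ⟨hl, hf, -⟩ := h36 i hM α₀ hα₀ ha U hU
    exact ⟨hl, hf⟩

/-! ## §5 The consumer face: the leaf at `W310OfOps` yields the (3.42) clauses of Theorem 3.3 for a kernel family -/

omit [∀ i, DecidableEq (geo i).Site] [∀ i, Fintype (X i)] [∀ i, DecidableEq (X i)] [∀ i, Fintype (Y i)]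
  [∀ i, DecidableEq (Y i)] [∀ i, Fintype (ι i)] [∀ i, Fintype (A i)] in
/-- **p. 416: «From (3.108) it follows that the expansion (3.107) is convergent in all norms in the inequalities
(3.42)–(3.47). This implies Theorem 3.3» — the (3.42) block, kernel-checked at the pinned expansion datum.**  If the four
model operators G(U), ∇_UG(U), G(U)∇\*_U, Δ_UG(U) of `𝔬 i` are CO-READ by the observation quantities e₀, …, e₃ of a kernel
family `GA i` (n06-c's `B9Thm37GlueCor36.CoRealizes`: e_n is the printed sup over the block, (3.39) ∕ (3.42) p. 397 — a reading
hypothesis, nothing asserted), then the leaf `B9.Thm310Printed` AT the sup-block pin `W310OfOps … (Conv3107 … C δ)` gives, under its own provisos (M ≧ M₂,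
0 < α₀, Mα₀ ≦ a₀, (3.35)), the four clauses (3.42) AS TYPED for `GA i` with the constants (C, δ) (`B9Thm37GlueCor36.Clause342`)
— the (3.42) block of the G-half of the summation leaf `B9.RWSumsYieldIneqs` ∕ of `B9.Thm33Printed`.
[cite: Balaban1985BackgroundPropagators, Thm 3.10 ⇒ Thm 3.3 p.416 + (3.42) p.397 + Thm 3.3 p.399] -/
theorem clause342_of_thm310Printed {𝔬 : ∀ i, Ops310 (geo i) (bg i) (X i) (Y i) (ι i) (A i)}
    {rd : ∀ i, WalkReading310 (geo i) (bg i) (X i) (ι i) (A i)} {R : I → ℝ} {H : I → Prop} {C δ : ℝ}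
    (GA : ∀ i, B9.KernelFamily (geo i) (bg i)) (ev : ∀ i, (geo i).Loc → X i → ℝ)
    (evY : ∀ i, (geo i).Loc → Y i → ℝ)
    (h310 : B9.Thm310Printed c35 geo bg (fun i => W310OfOps (𝔬 i) (rd i) (Conv3107 (𝔬 i) (R i) (H i) C δ)))
    (hC : 0 ≤ C) (hlen : ∀ i (y : (geo i).Site), 0 ≤ (geo i).len y)
    (hco0 : ∀ i U, B9Thm37GlueCor36.CoRealizes (GA i) 0 U (𝔬 i).blk (𝔬 i).blk (ev i) ((𝔬 i).G U))
    (hco1 : ∀ i U, B9Thm37GlueCor36.CoRealizes (GA i) 1 U (𝔬 i).blkY (𝔬 i).blk (ev i) ((𝔬 i).D U ∘ₗ (𝔬 i).G U))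
    (hco2 : ∀ i U, B9Thm37GlueCor36.CoRealizes (GA i) 2 U (𝔬 i).blk (𝔬 i).blkY (evY i) ((𝔬 i).G U ∘ₗ (𝔬 i).Dstar U))
    (hco3 : ∀ i U, B9Thm37GlueCor36.CoRealizes (GA i) 3 U (𝔬 i).blk (𝔬 i).blk (ev i) ((𝔬 i).Lap U ∘ₗ (𝔬 i).G U)) :
    ∃ M₂ a₀ : ℝ, 0 < M₂ ∧ 0 < a₀ ∧
      ∀ i : I, M₂ ≤ (geo i).M → ∀ α₀ : ℝ, 0 < α₀ → (geo i).M * α₀ ≤ a₀ →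
        ∀ U : (bg i).Cfg, (bg i).Reg335 c35 α₀ U → ∀ n : Fin 4, B9Thm37GlueCor36.Clause342 (GA i) n C δ U := by
  obtain ⟨M₂, a₀, δ₁, C₁, c₁, hM₂, ha₀, -, -, -, h⟩ := h310
  refine ⟨M₂, a₀, hM₂, ha₀, fun i hMi α₀ hα₀ hMa U hU => ?_⟩
  have hconv : Conv3107 (𝔬 i) (R i) (H i) C δ U := (h i hMi α₀ hα₀ hMa U hU).1
  obtain ⟨h0, h1, h2, h3⟩ := hconv
  exact B9Thm37GlueCor36.clause342_all (B9Thm37GlueCor36.clause342_e0_of_hasMajorant (hco0 i U) h0 hC (hlen i))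
    (B9Thm37GlueCor36.clause342_e1_of_hasMajorantHom (hco1 i U) h1 hC (hlen i))
    (B9Thm37GlueCor36.clause342_e2_of_hasMajorantHom (hco2 i U) h2 hC (hlen i))
    (B9Thm37GlueCor36.clause342_e3_of_hasMajorantHom (hco3 i U) h3 hC (hlen i))

end Family

/-! ## §6 The leaf from the cell's TYPED Corollary 3.6 `B9.Cor36Printed`, by name

p. 409 (verbatim): *"The operators constructed for this sequence, which we denote by G′_□(U), C_□(U) = (Q′(U)G′²_□(U)Q′\*(U))⁻¹,
G_□(U), satisfy all the inequalities of Theorems 3.1–3.3 correspondingly."*  The local sequences {Ω_n(□)}, □ ∈ 𝒟 of the member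
i, are themselves members of the printed family; below, the cell's typed Corollary 3.6 is taken over the Σ-family `(i, □)` with
geometry `geo i`, and the four words G_□(U), ∇_UG_□(U), G_□(U)∇\*_U, Δ_UG_□(U) of `Ops310` are REALIZED (`B9SectCDiffDict.Realizes`,
the cell's reading hypothesis) by the observation quantities e₀, …, e₃ of that member's G-family `GAL`.  Then `Local342G` follows
from the G-half of `B9.Cor36Printed` (`B9Thm37GlueCor36.hasMajorant_e0_of_ineq342` &c.) — the mirror of
`B9Thm37Whole.local342_of_cor36Printed` on the G′-half. -/

section FromCor36

variable {I : Type} {c35 : ℝ} {geo : I → B9.Geometry} {bg : I → B9.Backgrounds}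
variable [∀ i, Fintype (geo i).Site] [∀ i, DecidableEq (geo i).Site]
variable {X Y ι A : I → Type} [∀ i, Fintype (X i)] [∀ i, DecidableEq (X i)] [∀ i, Fintype (Y i)]
  [∀ i, DecidableEq (Y i)] [∀ i, Fintype (ι i)] [∀ i, Fintype (A i)]

omit [∀ i, Fintype (ι i)] [∀ i, Fintype (A i)] in
/-- **«The operators G_□(U) … satisfy all the inequalities of Theorems 3.1–3.3» (p. 409) ⇒ `Local342G`, FROM THE TYPED
COROLLARY 3.6.**  With `B9.Cor36Printed` over the Σ-family of the local sequences {Ω_n(□)} (every □ ∈ 𝒟 of every member lies in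
a cube of the class of (3.35): `hIn`) and the four words of G_□(U) realized by e₀, …, e₃ of the local G-family `GAL ⟨i, □⟩`
(`Realizes`, hypotheses `hR0 … hR3`), Corollary 3.6's constants a₁, M₁, B₀, δ₀ serve every member: for M ≧ M₁, 0 < α₀,
O(1)Mα₀ ≦ a₁ and U satisfying (3.35), `Local342G (𝔬 i) (R i) (H i) B₀ δ₀ U`.  Corollary 3.6 is NOT asserted (hypothesis
`h36`). [cite: Balaban1985BackgroundPropagators, Cor. 3.6 p.408 + p.409 + (3.42) p.397 + Thm 3.3 p.399] -/
theorem local342G_of_cor36Printed {d : ℕ} (𝔬 : ∀ i, Ops310 (geo i) (bg i) (X i) (Y i) (ι i) (A i)) (R : I → ℝ)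
    (H : I → Prop) {InCube : (Σ i, ι i) → Prop} {GpL GAL : ∀ p : (Σ i, ι i), B9.KernelFamily (geo p.1) (bg p.1)}
    {CinvL : ∀ p : (Σ i, ι i), B9.SiteKernel (geo p.1) (bg p.1)}
    (h36 : B9.Cor36Printed d c35 (fun p : (Σ i, ι i) => geo p.1) (fun p => bg p.1) InCube GpL GAL CinvL)
    (hIn : ∀ i (q : ι i), InCube ⟨i, q⟩) (hlen : ∀ i (y : (geo i).Site), 0 ≤ (geo i).len y)
    (hR0 : ∀ i (q : ι i) (U : (bg i).Cfg),
      B9SectCDiffDict.Realizes (GAL ⟨i, q⟩) 0 U (𝔬 i).blk (𝔬 i).blk (LinearMap.toMatrix' ((𝔬 i).Gsq U q)))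
    (hR1 : ∀ i (q : ι i) (U : (bg i).Cfg),
      B9SectCDiffDict.Realizes (GAL ⟨i, q⟩) 1 U (𝔬 i).blkY (𝔬 i).blk (LinearMap.toMatrix' ((𝔬 i).D U ∘ₗ (𝔬 i).Gsq U q)))
    (hR2 : ∀ i (q : ι i) (U : (bg i).Cfg),
      B9SectCDiffDict.Realizes (GAL ⟨i, q⟩) 2 U (𝔬 i).blk (𝔬 i).blkY
        (LinearMap.toMatrix' ((𝔬 i).Gsq U q ∘ₗ (𝔬 i).Dstar U)))
    (hR3 : ∀ i (q : ι i) (U : (bg i).Cfg),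
      B9SectCDiffDict.Realizes (GAL ⟨i, q⟩) 3 U (𝔬 i).blk (𝔬 i).blk (LinearMap.toMatrix' ((𝔬 i).Lap U ∘ₗ (𝔬 i).Gsq U q))) :
    ∃ a₁ M₁ B₀ δ₀ : ℝ, 0 < a₁ ∧ 0 < M₁ ∧ 0 < B₀ ∧ 0 < δ₀ ∧
      ∀ i : I, M₁ ≤ (geo i).M → ∀ α₀ : ℝ, 0 < α₀ → c35 * (geo i).M * α₀ ≤ a₁ →
        ∀ U : (bg i).Cfg, (bg i).Reg335 c35 α₀ U → Local342G (𝔬 i) (R i) (H i) B₀ δ₀ U := by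
  obtain ⟨a₁, M₁, B₀, δ₀, Bβ, Bε, Bεβ, B₁, δ₁, ha₁, hM₁, hB₀, hδ₀, -, -, hall⟩ := h36
  refine ⟨a₁, M₁, B₀, δ₀, ha₁, hM₁, hB₀, hδ₀, fun i hM α₀ hα₀ ha U hU => ?_⟩
  have hI : ∀ q : ι i, B9.Ineq342_346_347 (GAL ⟨i, q⟩) B₀ δ₀ U := fun q =>
    (hall ⟨i, q⟩ (hIn i q) hM α₀ hα₀ ha U hU).2.2.1
  exact ⟨fun q => B9Thm37GlueCor36.hasMajorant_e0_of_ineq342 (hI q) (hR0 i q U) hB₀.le (hlen i),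
    fun q => B9Thm37GlueCor36.hasMajorantHom_e1_of_ineq342 (hI q) (hR1 i q U) hB₀.le (hlen i),
    fun q => B9Thm37GlueCor36.hasMajorantHom_e2_of_ineq342 (hI q) (hR2 i q U) hB₀.le (hlen i),
    fun q => B9Thm37GlueCor36.hasMajorantHom_e3_of_ineq342 (hI q) (hR3 i q U) hB₀.le (hlen i)⟩

/-- ★ **THEOREM 3.10 AS THE WHOLE PRINTED LEAF, FROM THE CELL'S TYPED COROLLARY 3.6 BY NAME** (p. 415: *"The above
considerations give Theorem 3.10"* — the considerations being Cor. 3.6 for the local operators, (3.105)–(3.106) and the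
smallness of R): `B9.Cor36Printed` over the Σ-family of the local sequences (with the `Realizes` readings of the four words of
G_□(U)), the (3.89)-type factor bounds and the structure of the expansion at the regular configurations (`Factors389`,
`Identities310`; the factors at their own rate δ_F > 0), the static data, Leibniz sizes, readings, locality inputs, and [4]
Lemma 2.1 (2.61) in its printed «RM sufficiently large» form at the exponent α (for every rate an M-threshold) give the leaf
`B9.Thm310Printed c35 geo bg (fun i => W310OfOps … (Conv3107 … C δ))` for SOME constants C ≧ 0, δ > 0 (C = `const37 …` and δ = (1 − 2α)δ⋆
at the common rate δ⋆ = min(δ₀, δ_F) of Corollary 3.6's δ₀ and the factors' δ_F, `Local342G.of_rate_le`, `Factors389.of_rate_le`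
— existential, as print's *"The constant O(1) depends on d and L only"*).  Nothing of print asserted;
NOT a node discharge. [cite: Balaban1985BackgroundPropagators, Thm 3.10 pp.415–416 + Cor. 3.6 p.408; Balaban1984PropagatorsII, Lemma 2.1 (2.59)–(2.61) pp.233–234] -/
theorem thm310Printed_of_cor36Printed {d : ℕ} (𝔬 : ∀ i, Ops310 (geo i) (bg i) (X i) (Y i) (ι i) (A i))
    (rd : ∀ i, WalkReading310 (geo i) (bg i) (X i) (ι i) (A i)) (R : I → ℝ) (H : I → Prop) (κ : I → Sizes310)
    (α ρ N N' NF Cℓ K θ₀ : ℝ) {InCube : (Σ i, ι i) → Prop}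
    {GpL GAL : ∀ p : (Σ i, ι i), B9.KernelFamily (geo p.1) (bg p.1)}
    {CinvL : ∀ p : (Σ i, ι i), B9.SiteKernel (geo p.1) (bg p.1)}
    (hc : 0 < c35) (hα : 0 ≤ α) (hα2 : α < 1 / 2) (hN : 0 ≤ N) (hN' : 0 ≤ N') (hNF : 0 ≤ NF) (hCℓ : 1 ≤ Cℓ)
    (hK : 0 ≤ K) (hθ₀ : 0 ≤ θ₀)
    (hst : ∀ i, StaticOK310 (𝔬 i) ρ N N' NF Cℓ (κ i)) (hκ : ∀ i, (κ i).Bounded K)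
    (hrd : ∀ i, (rd i).OK (𝔬 i).blk) (hloc : ∀ i, Locality310 (𝔬 i) (rd i))
    (hL21 : ∀ δ₀ : ℝ, 0 < δ₀ → ∃ ML : ℝ, ∀ i, ML ≤ (geo i).M → Ineq261 d (toB6 (geo i) (R i) (H i)) δ₀ α)
    (h36 : B9.Cor36Printed d c35 (fun p : (Σ i, ι i) => geo p.1) (fun p => bg p.1) InCube GpL GAL CinvL)
    (hIn : ∀ i (q : ι i), InCube ⟨i, q⟩)
    (hR0 : ∀ i (q : ι i) (U : (bg i).Cfg),
      B9SectCDiffDict.Realizes (GAL ⟨i, q⟩) 0 U (𝔬 i).blk (𝔬 i).blk (LinearMap.toMatrix' ((𝔬 i).Gsq U q)))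
    (hR1 : ∀ i (q : ι i) (U : (bg i).Cfg),
      B9SectCDiffDict.Realizes (GAL ⟨i, q⟩) 1 U (𝔬 i).blkY (𝔬 i).blk (LinearMap.toMatrix' ((𝔬 i).D U ∘ₗ (𝔬 i).Gsq U q)))
    (hR2 : ∀ i (q : ι i) (U : (bg i).Cfg),
      B9SectCDiffDict.Realizes (GAL ⟨i, q⟩) 2 U (𝔬 i).blk (𝔬 i).blkY
        (LinearMap.toMatrix' ((𝔬 i).Gsq U q ∘ₗ (𝔬 i).Dstar U)))
    (hR3 : ∀ i (q : ι i) (U : (bg i).Cfg),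
      B9SectCDiffDict.Realizes (GAL ⟨i, q⟩) 3 U (𝔬 i).blk (𝔬 i).blk (LinearMap.toMatrix' ((𝔬 i).Lap U ∘ₗ (𝔬 i).Gsq U q)))
    (δF : ℝ) (hδF : 0 < δF)
    (hfi : ∀ i (α₀ : ℝ) (U : (bg i).Cfg), 0 < α₀ → (bg i).Reg335 c35 α₀ U →
      Factors389 (𝔬 i) (R i) (H i) θ₀ δF U ∧ Identities310 (𝔬 i) (R i) (H i) U) :
    ∃ C δ : ℝ, 0 ≤ C ∧ 0 < δ ∧
      B9.Thm310Printed c35 geo bg (fun i => W310OfOps (𝔬 i) (rd i) (Conv3107 (𝔬 i) (R i) (H i) C δ)) := by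
  have hlen : ∀ i (y : (geo i).Site), 0 ≤ (geo i).len y := fun i y => ((hst i).lenpos y).le
  obtain ⟨a₁, M₁, B₀, δ₀, ha₁, hM₁, hB₀, hδ₀, hl⟩ :=
    local342G_of_cor36Printed 𝔬 R H h36 hIn hlen hR0 hR1 hR2 hR3
  -- the common rate δ⋆ = min(δ₀, δ_F) of the legs and of the factors
  have hδ : 0 < min δ₀ δF := lt_min hδ₀ hδF
  obtain ⟨ML, h261⟩ := hL21 (min δ₀ δF) hδ
  have hCℓ0 : 0 ≤ Cℓ := le_trans zero_le_one hCℓ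
  refine ⟨const37 d (min δ₀ δF) α ρ B₀ N N' Cℓ K, (1 - 2 * α) * min δ₀ δF, ?_, mul_pos (by linarith) hδ, ?_⟩
  · simp only [const37]
    exact mul_nonneg (mul_nonneg (mul_nonneg (by norm_num) hB₀.le)
      (add_nonneg hN (mul_nonneg (mul_nonneg (mul_nonneg hN' (Real.exp_nonneg _)) hCℓ0) hK)))
      (c1_nonneg d (min δ₀ δF) α)
  · refine thm310Printed_of_local3107 𝔬 rd R H κ d α ρ N N' NF Cℓ K θ₀ B₀ (min δ₀ δF) a₁ M₁ (max ML M₁) hc hα hα2.le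
      hN hN' hNF hCℓ hK hθ₀ hB₀ hδ ha₁ hM₁ hst hκ hrd hloc (fun i hM => h261 i (le_trans (le_max_left _ _) hM))
      (fun i hM α₀ hα₀ ha U hU => ?_)
    have hMpos : 0 < (geo i).M := lt_of_lt_of_le hM₁ hM
    have hθ : 0 ≤ θ₀ * (geo i).M⁻¹ := mul_nonneg hθ₀ (inv_nonneg.mpr hMpos.le)
    obtain ⟨hf, hi⟩ := hfi i α₀ U hα₀ hU
    exact ⟨(hl i hM α₀ hα₀ ha U hU).of_rate_le hB₀.le (min_le_left _ _) (hst i).dnn (hlen i),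
      hf.of_rate_le hθ (min_le_right _ _) (hst i).dnn (hlen i), hi⟩

end FromCor36

end

end Literature.MathematicalPhysics.QuantumFieldTheory.Balaban1983to89.B9Thm310Whole
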